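import Literature.MathematicalPhysics.QuantumFieldTheory.Balaban1983to89.B9Thm34HolderInputGp
import Literature.MathematicalPhysics.QuantumFieldTheory.Balaban1983to89.B9Thm34SectBUniformR1

/-!
# `Balaban1983to89.B9Thm34HolderGpUniformR1` — [Balaban1985BackgroundPropagators] THEOREM 3.4 p. 400, THE HÖLDER MEMBERS OF `G′(U′U)` WITH THE
# CONSTANTS CHOSEN BEFORE THE LATTICE — (3.43) with the derivative on the left / on the right (r06 FILE 54 `B9Thm34HolderLeftUniform` §1, §3) and the
# INPUT-Hölder members (3.44)/(3.45) (r06 FILE 57 `B9Thm34HolderInputGpUniform`) — RESTATED WITH THE [4] LEMMA 2.1 INPUTS ASKED ONLY FOR THE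
# EXPONENTS THE PROOFS USE: `9/5000 ≤ α` instead of `0 < α` («R1» of the pub-ymgap N06 row-13 lineage, seat dag-n06-c gen 4; statement-only
# change, proofs verbatim; the `G′`-only — kernel-free — part of the Hölder chain)

statement-level skeleton of published theorems with citation tags; proofs where landed; nothing here is a claim about the Yang–Mills mass gap

CITATION HEADER (lean-in-tree rule).  B9 = T. Bałaban, *Propagators for lattice gauge theories in a background field*, Commun. Math. Phys.
**99** (1985) 389–434 [Balaban1985BackgroundPropagators] (held `paper:balaban1985-cmp99-background-propagators`; journal page = PDF page + 388):
Theorem 3.4 p. 400 [PDF 12] L7–10 «There exists a positive constant a₁ such that the operators G′(U), (Q′(U)G′²(U)Q′*(U))⁻¹, R(U), G(U) extend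
to configurations U′U for α₁ ≦ a₁ as analytic functions of A. The extended operators satisfy all the inequalities of Theorems 3.1–3.3
correspondingly»; Theorem 3.1 p. 397 [PDF 9] «There exist positive constants M₁, δ₀, a₀, B₀ dependent on d and L only»; (3.43) p. 398 [PDF 10]
«‖ζ∇_UG′(U)λ‖_β, ‖ζG′(U)∇*_Uλ‖_β ≦ B₀(β₀)(Lʲη)^{1−β}·(‖ζ‖_β^ξ + |ζ|)e^{−δ₀d(y,y′)}|λ|, ξ = L^{−j}, for 0 ≦ β ≦ β₀ < 1, ζ ∈ C₀^∞(Δ̃(y)), y ∈ Λ_j,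
supp λ ⊂ Δ(y′)»; (3.44)–(3.45) p. 398 «|(∇_UG′(U)∇*_Uλ)(x)| ≦ B′₀(ε)(‖λ‖_ε^{ξ′}(L^{j′}η)^ε + |λ|)e^{−δ₀d(y,y′)} for 0 < ε ≦ 1, x ∈ Δ(y),
supp λ ⊂ Δ̃(y′)» and its Hölder-output twin; the Hölder norm (3.40) p. 397; p. 399 [PDF 11] L1–3 «Let us stress that the constants in the
formulations of both theorems do not depend on the sequence {Ω_j}, j = 0, 1, …, k, if the conditions (2.1), (2.2) are satisfied»; p. 403 [PDF 15]
l. 1–9 «Now applying Theorem 3.1 for G′(U), the bound (3.63), the representation (3.64) and Lemma 2.1 of [4] we can prove all the statements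
(3.42)–(3.47) of Theorem 3.1 for the operator G′(U′U), of course with different constants»; (3.60)–(3.65) pp. 402–403; p. 398 remark after (3.47)
(scale transfer).  [4] = [Balaban1984PropagatorsII] (2.51)–(2.55) p. 232; Lemma 2.1 p. 234 [PDF 12]: «For the numbers α, 0 < α < 1, c₁(α) = 12c₀(½α),
and RM satisfying (2.59) … (2.60) … (2.61)»; (2.59) p. 233 [PDF 11]: «Now we require that RM is sufficiently large, i.e. we assume ¼αδ₀RM > 2d log
c₀(½α) + 1. (2.59)».  Rows B9.Thm3.4 × B9.Thm3.1 ((3.43)/(3.44)/(3.45) cells) × B9.Eq3.62 × B6.Lemma2.1 (cells only; no row head changes).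

WHY THIS FILE (pub-ymgap N06 row 13, dag-n06-c LOCATED-4, pub-ymgap INBOX 2026-08-27 ≈01:47Z/02:01Z; sibling of `…B9Thm34SectBUniformR1`, whose
header states the case in full).  r06's FILES 54/57 hypothesise [4] Lemma 2.1 in the shape «for EVERY 0 < α < 1» (`∀ α, 0 < α → α < 1 → Ineq261
d 𝔅 δ₀ α`, `∀ α, 0 < α → ScaleTransfer …`) with no trace of the printed size condition (2.59), whose M-threshold grows without bound as α → 0 —
FALSE over every multiscale family with unboundedly many scales at fixed M, although the proofs USE the two binders at literal exponents only
(1/100, 1/25, 1/20 here; ≥ 9/5000 across the chain).  THIS FILE holds the three `G′`-ONLY theorems of FILES 54/57 — the part of the Hölder chain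
that does not route through `B9Thm34AllUniform` and its kernel-form letters — with the two binder texts `0 < α → α < 1 → Ineq261 …` ⟶
`9 / 5000 ≤ α → α < 1 → Ineq261 …`, `0 < α → ScaleTransfer …` ⟶ `9 / 5000 ≤ α → ScaleTransfer …`, the callee `thm34_Gp_uniform` taken from the
R1 sibling `…B9Thm34SectBUniformR1`, and NOTHING ELSE changed (proofs byte for byte).  FILE 54 §2 `thm34_all_holderLeft_uniform` (the `G(U′U)`
member, which needs `thm34_all_uniform`'s kernel-form letters for `G(U)`) is deliberately NOT restated: the lit-balaban desk (pub-ymgap ME #13,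
2026-08-26) records that block-uniform pointwise kernel bounds of that shape are not satisfied by Bałaban's own propagators on multi-point blocks
for d ≥ 3, so no genuine instance would call it.  Count-neutral, supersedable by an in-place edit of the r06 chain.

WHAT IS PROVED (3 theorems: 0 `def`, 0 sorry, 0 new named facts; standard axioms) — under FILES 54/57's short names in the namespace
`…B9Thm34HolderGpUniformR1`:
* §1 **`thm34_Gp_holderLeft_uniform`** (FILE 54 §1) — for every left letter `D`, every `ℝ`-linear `𝔸`-valued functional `Φ`, anchor `y ∋ p₀`, `β`,
  `B_h, c_ζ ≧ 0`: IF `‖Φ(D G′(U)λ)‖ ≦ B_h(Lʲη)^{1−β}c_ζe^{−δ₀d(y,y′)}|λ|` for every `λ` supported in `Δ(y′)` THEN `‖Φ(D G′(U′U)λ)‖ ≦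
  B·B_h(Lʲη)^{1−β}c_ζe^{−(9δ₀/10)d(y,y′)}|λ|`; `∃ a₁ > 0 ∃ B ≧ 0` before the lattice.
* §2 **`thm34_Gp_holderRight_uniform`** (FILE 54 §3) — the (3.43) member with the derivative on the RIGHT for `G′(U′U)`.
* §3 **`thm34_Gp_holderInput_uniform`** (FILE 57) — (i) `G′(U′U)` = two-sided inverse of `Δ′_a(U) − V′(A)`; (v′) the (3.44)-type and (vi′) the
  (3.45)-type member for every left letter `D_l`, right letter `D_s`, block-supported input `λ` and input data `N`, `N₂` of `G′(U)`, at `(B, 4δ₀/5)`.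
All three: [4] Lemma 2.1 (2.61) and the p. 398 scale transfer hypothesised FOR `9/5000 ≦ α (< 1)`.

PROOF.  r06's FILES 54/57 proofs verbatim (FILE 34 `B9Thm34HolderLeftFinal` devices, gen 9 `B9Ineq363Vprime.hasMajorant_gp_vPrime`,
`B9Ineq366CPrime.hasMajorant_comp_decay_left1`, `B9Thm34GKernelFinal.exists_bound_of_continuousAt`, FILE 38 `B9Thm34HolderInputGp`,
`B9Thm34HolderInputG.input344_of_inverse`/`input345_of_inverse` — all BY NAME; callee `…B9Thm34SectBUniformR1.thm34_Gp_uniform`).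

HONEST SCOPE / NOT CLAIMED.  As FILES 54/57 (Theorem 3.1 FOR `U` and the (3.43)–(3.45)-type bounds FOR `U` per functional are inputs; (3.37) read
blockwise; letters as block-majorant hypotheses of the printed shape; rates one admissible choice).  The ONLY difference is the weaker Lemma-2.1
hypothesis; 9/5000 is a proof constant of the r06 chain, not a printed number.  Nothing of [B9] is asserted; no row head changes; NOT a node
discharge; nothing continuum / OS / mass-gap / Clay.

RELATED IN THE TREE, NOT DUPLICATED: FILES 54 `B9Thm34HolderLeftUniform` / 57 `B9Thm34HolderInputGpUniform` (the «∀ 0 < α < 1» statements;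
kept — they have importers), FILES 34/38 (per-lattice finals) and everything they use BY NAME; no existing module modified.
-/

noncomputable section

namespace Literature.MathematicalPhysics.QuantumFieldTheory.Balaban1983to89.B9Thm34HolderGpUniformR1

open NormedSpace Complex
open Literature.MathematicalPhysics.QuantumFieldTheory.Balaban1983to89
open Literature.MathematicalPhysics.QuantumFieldTheory.Balaban1983to89.B6RandomWalk (HasMajorant BlockSupp hasMajorant_mono Triangle254 Ineq261)
open Literature.MathematicalPhysics.QuantumFieldTheory.Balaban1983to89.B6RandomWalkHom (HasMajorantHom)
open Literature.MathematicalPhysics.QuantumFieldTheory.Balaban1983to89.B6RandomWalkKernel (HasKernelBound)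
open Literature.MathematicalPhysics.QuantumFieldTheory.Balaban1983to89.B6RandomWalkSection (secExt secRes secConj)
open Literature.MathematicalPhysics.QuantumFieldTheory.Balaban1983to89.B9Thm34Ext (toB6)
open Literature.MathematicalPhysics.QuantumFieldTheory.Balaban1983to89.B9Ineq347 (ScaleTransfer)
open Literature.MathematicalPhysics.QuantumFieldTheory.Balaban1983to89.B9Eq386Neumann (pTwo deltaA)
open Literature.MathematicalPhysics.QuantumFieldTheory.Balaban1983to89.B9Eq39Adjoint
open Literature.MathematicalPhysics.QuantumFieldTheory.Balaban1983to89.B9Eq369Small (Through)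
open Literature.MathematicalPhysics.QuantumFieldTheory.Balaban1983to89.B9Eq372Locality (stBonds)
open Literature.MathematicalPhysics.QuantumFieldTheory.Balaban1983to89.B9Eq352DivForm (tauF tauB)
open Literature.MathematicalPhysics.QuantumFieldTheory.Balaban1983to89.B9Eq352DivFormLetters
open Literature.MathematicalPhysics.QuantumFieldTheory.Balaban1983to89.B9Eq352GradLetters (diffLetter)
open Literature.MathematicalPhysics.QuantumFieldTheory.Balaban1983to89.B9Eq371GradLetters (bT bU)
open Literature.MathematicalPhysics.QuantumFieldTheory.Balaban1983to89.B9Eq372RemLetters (lapDDLetter)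
open Literature.MathematicalPhysics.QuantumFieldTheory.Balaban1983to89.B9Eq382V3Letters (dPrimeLetter)
open Literature.MathematicalPhysics.QuantumFieldTheory.Balaban1983to89.B9Eq376POneLetters (conjHom gradLin divLin)
open Literature.MathematicalPhysics.QuantumFieldTheory.Balaban1983to89.B9Eq360Vprime (gPrimeExtEnd)
open Literature.MathematicalPhysics.QuantumFieldTheory.Balaban1983to89.B9Eq360VprimeLetters (vPrimeConc)
open Literature.MathematicalPhysics.QuantumFieldTheory.Balaban1983to89.B9Thm34SectBUniformR1 (thm34_Gp_uniform)
open Literature.MathematicalPhysics.QuantumFieldTheory.Balaban1983to89.B9Ineq385VG (kappa385)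
open Literature.MathematicalPhysics.QuantumFieldTheory.Balaban1983to89.B9Eq360VprimeLetters (cBConc)
open Literature.MathematicalPhysics.QuantumFieldTheory.Balaban1983to89.B9Ineq363Vprime (cVConc thetaL363 thetaL363_nonneg hasMajorant_gp_vPrime)
open Literature.MathematicalPhysics.QuantumFieldTheory.Balaban1983to89.B9Ineq366CPrime (hasMajorant_rate_mono hasMajorant_comp_decay_left1)
open Literature.MathematicalPhysics.QuantumFieldTheory.Balaban1983to89.B9Thm34GKernelFinal (exists_bound_of_continuousAt)
open Literature.MathematicalPhysics.QuantumFieldTheory.Balaban1983to89.B6RandomWalk (hasMajorant_add)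
open Literature.MathematicalPhysics.QuantumFieldTheory.Balaban1983to89.B9Thm34HolderLeftFinal (hasMajorant_pointProbe_mul
  probe_le_of_hasMajorant_pointProbe_mul probe_transfer norm_le_sum_norm_mul_of_repr_le norm_probe_transfer pointProbe_apply coordProbe_apply
  holderQuot340_apply thetaL363_linear)

open Literature.MathematicalPhysics.QuantumFieldTheory.Balaban1983to89.B6RandomWalk (HasMajorant BlockSupp hasMajorant_mono hasMajorant_zero Triangle254 Ineq261)
open Literature.MathematicalPhysics.QuantumFieldTheory.Balaban1983to89.B9Eq386Neumann (vTotal)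
open Literature.MathematicalPhysics.QuantumFieldTheory.Balaban1983to89.B9Eq352GradLetters (V0op coefLetter diffLetter hasMajorant_coefLetter)
open Literature.MathematicalPhysics.QuantumFieldTheory.Balaban1983to89.B9Eq360VprimeLetters (avgOp vPrimeConc conj_vPrimeConc_eq_gradForm hasMajorant_V0_vPrime)
open Literature.MathematicalPhysics.QuantumFieldTheory.Balaban1983to89.B9Ineq363Vprime (cVConc cVConc_nonneg)
open Literature.MathematicalPhysics.QuantumFieldTheory.Balaban1983to89.B9Ineq385Kernel (exp_rate_mono)
open Literature.MathematicalPhysics.QuantumFieldTheory.Balaban1983to89.B9Thm34HolderInputG (input344_of_inverse input345_of_inverse)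

section HolderU1

variable {𝔸 : Type*} [NormedRing 𝔸] [NormedAlgebra ℂ 𝔸] [CompleteSpace 𝔸] {ι : Type} [Fintype ι]
variable (b : Module.Basis ι ℝ 𝔸) (κ : Type) [Fintype κ]

set_option maxHeartbeats 800000 in
/-- **THEOREM 3.4, THE (3.43)-TYPE HÖLDER MEMBERS OF `G′(U′U)` WITH THE DERIVATIVE ON THE LEFT, CONSTANTS BEFORE THE LATTICE** («The extended
operators satisfy all the inequalities of Theorems 3.1–3.3 correspondingly», p. 400; «the constants … do not depend on the sequence {Ω_j}», p. 399;
(3.43) p. 398): for fixed `d`, `κ`, `(𝔸, b, M₂)`, input constants and ONE scale-transfer function `Λ(·) ≧ 1`, THERE EXIST `a₁ > 0`, `B ≧ 0` such that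
FOR EVERY lattice `(S, T)`, geometry `𝔅 = g` with `blk`, background `U`, (3.19)/(3.24)/(3.60) data and `G′(U) = (Δ′_a(U))⁻¹` with Theorem 3.1
(3.42)₁₋₃ at `(B_G, δ₀)`: for all `0 ≦ α₁ ≦ a₁`, all `A` in (3.37) (blockwise), (3.59) kernels, every left letter `D`, every `ℝ`-linear `𝔸`-valued
functional `Φ`, anchor `y ∋ p₀`, `β`, `B_h, c_ζ ≧ 0`: IF `‖Φ(D G′(U)λ)‖ ≦ B_h(Lʲη)^{1−β}c_ζe^{−δ₀d(y,y′)}|λ|` for every `λ` supported in `Δ(y′)`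
((3.43) for `U` read for this functional) THEN `‖Φ(D G′(U′U)λ)‖ ≦ B·B_h(Lʲη)^{1−β}c_ζe^{−(9δ₀/10)d(y,y′)}|λ|` — FILE 34 `thm34_Gp_holderLeft_final`
verbatim, re-quantified (`B = (Σ_i‖b_i‖)M₂B⁽⁴⁵⁾/B_G`). (R1: [4] Lemma 2.1 (2.61) and the p. 398 scale transfer are hypothesised for the exponents
`9/5000 ≦ α` only — the ones the proof uses — instead of r06's «every 0 < α < 1»; nothing else differs from the r06 original.)
[cite: Balaban1985BackgroundPropagators, Thm 3.4 p.400 + p.399 + Thm 3.1 (3.43) p.398 + (3.40) p.397 + (3.62)–(3.65) pp.402–403 + p.403 l.1–9; Balaban1984PropagatorsII, (2.51) p.232 + Lemma 2.1 p.234] -/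
theorem thm34_Gp_holderLeft_uniform [DecidableEq ι] (d : ℕ)
    (δ₀ BG Cq a₀ d₀ M₂ : ℝ) (Λf : ℝ → ℝ)
    (hBG : 0 < BG) (hCq : 0 ≤ Cq) (ha₀ : 0 ≤ a₀) (hM₂ : 0 ≤ M₂) (hδ₀ : 0 < δ₀) (hΛf : ∀ α : ℝ, 0 < α → 1 ≤ Λf α)
    (hrepr : ∀ (v : 𝔸) (i : ι), |b.repr v i| ≤ M₂ * ‖v‖) :
    ∃ a₁ : ℝ, 0 < a₁ ∧ ∃ B : ℝ, 0 ≤ B ∧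
    ∀ {S : Type} [Fintype S] [DecidableEq S] (T : κ → Equiv.Perm S) (U : κ → S → 𝔸ˣ)
      {g : B9.Geometry} [Fintype g.Site] [DecidableEq g.Site] [Nonempty g.Site] {Rr : ℝ} {H : Prop} (blk : S → g.Site)
      (kQ : g.Site → S → 𝔸 →L[ℝ] 𝔸) (sQ : S → 𝔸 →L[ℝ] 𝔸) (cfun w : g.Site → ℝ)
    -- the multiscale geometry 𝔅 (p. 393, [4] (2.1)–(2.4)) and its axioms
    (hdnn : ∀ a a' : g.Site, 0 ≤ g.dist a a') (htri : Triangle254 (toB6 g Rr H)) (hrefl : ∀ y : g.Site, g.dist y y = 0)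
    (hsym : ∀ y y' : g.Site, g.dist y y' = g.dist y' y) (hlen : ∀ y : g.Site, 0 < g.len y) (hlenη : ∀ y : g.Site, g.eta ≤ g.len y)
    (hη : 0 < g.eta)
    -- [4] Lemma 2.1 (2.61) at the rate `δ₀`, for every exponent `9/5000 ≤ α < 1` (R1: the exponents the proof uses; print: «0 < α < 1» with (2.59)), and the p. 398 scale transfer for the same exponents
    (h261 : ∀ α : ℝ, 9 / 5000 ≤ α → α < 1 → Ineq261 d (toB6 g Rr H) δ₀ α)
      (hST : ∀ α : ℝ, 9 / 5000 ≤ α → ScaleTransfer g δ₀ α (Λf α) (fun a => g.len a) ∧ ScaleTransfer g δ₀ α (Λf α) (fun a => g.len a ^ 2) ∧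
        ScaleTransfer g δ₀ α (Λf α) (fun a => (g.len a)⁻¹) ∧ ScaleTransfer g δ₀ α (Λf α) (fun a => (g.len a ^ 2)⁻¹) ∧
        ScaleTransfer g δ₀ α (Λf α) (fun a => (g.len a ^ 4)⁻¹) ∧ ScaleTransfer g δ₀ α (Λf α) (fun y => g.len y ^ (-(4 : ℝ))))
    (hU1 : ∀ m z, ‖((U m z : 𝔸ˣ) : 𝔸)‖ ≤ 1 ∧ ‖(((U m z)⁻¹ : 𝔸ˣ) : 𝔸)‖ ≤ 1)
    (hd₀B : ∀ μ x, g.dist (blk x) (blk ((T μ).symm x)) ≤ d₀) (hd₀F : ∀ μ x, g.dist (blk x) (blk (T μ x)) ≤ d₀)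
    (hd₀0 : ∀ y : g.Site, g.dist y y ≤ d₀)
    -- the `A`-independent data of the concrete `V′(A)` of (3.60)
    (hw : ∀ y, 0 ≤ w y) (hcard : ∀ y, ((B9Eq360Vprime.block blk y).card : ℝ) * w y ≤ 1)
    (hkQ : ∀ y x, blk x = y → ‖kQ y x‖ ≤ w y) (hsQ : ∀ x, ‖sQ x‖ ≤ 1) (hcfun : ∀ y, |cfun y| ≤ a₀ * (g.len y ^ 2)⁻¹)
    -- THEOREM 3.1 for `G′(U)`: (3.24) `G′(U) = (Δ′_a(U))⁻¹` for the letter `Δ′_a(U)`, and (3.42)₁,₂,₃ at the rate `δ₀`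
    {Δp Gp : Module.End ℝ (S × ι → ℝ)} (hΔpGp : Δp * Gp = 1) (hGpΔp : Gp * Δp = 1)
    (h342_1 : HasMajorant (g := toB6 g Rr H) (fun p : S × ι => blk p.1) Gp
      (fun a a' => BG * g.len a ^ 2 * Real.exp (-(δ₀ * g.dist a a'))))
    (h342_2 : ∀ k : κ ⊕ κ, HasMajorant (g := toB6 g Rr H) (fun p : S × ι => blk p.1)
      (conj b (diffLetter T U ((g.eta : ℂ)⁻¹) k) * Gp) (fun a a' => BG * g.len a * Real.exp (-(δ₀ * g.dist a a'))))
    (h342_3 : ∀ k : κ ⊕ κ, HasMajorant (g := toB6 g Rr H) (fun p : S × ι => blk p.1)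
      (Gp * conj b (diffLetter T U ((g.eta : ℂ)⁻¹) k)) (fun a a' => BG * g.len a * Real.exp (-(δ₀ * g.dist a a')))),
    ∀ (α₁ : ℝ), 0 ≤ α₁ → α₁ ≤ a₁ →
    -- the exponent field `A` in the domain (3.37), read blockwise, and the `A`-dependent (3.59) data `kF`, `sF`
    ∀ (A : κ → S → 𝔸) (kF : g.Site → S → 𝔸 →L[ℝ] 𝔸) (sF : S → 𝔸 →L[ℝ] 𝔸),
      (∀ y x, blk x = y → ‖kF y x‖ ≤ Cq * α₁ * w y) → (∀ x, ‖sF x‖ ≤ Cq * α₁) →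
      (∀ ν k x, ‖((g.eta : ℂ)⁻¹) • covDstar T U ν (A k) x‖ ≤ α₁ * (g.len (blk x) ^ 2)⁻¹) →
      (∀ μ ν x, ‖((g.eta : ℂ)⁻¹) • covD T U μ (A ν) x‖ ≤ α₁ * (g.len (blk x) ^ 2)⁻¹) →
      (∀ μ x, ‖((g.eta : ℂ)⁻¹) • covDstar T U μ (tauB T U μ (A μ)) x‖ ≤ α₁ * (g.len (blk x) ^ 2)⁻¹) →
      (∀ k x, ‖A k x‖ ≤ α₁ * (g.len (blk x))⁻¹) → (∀ ν k x, ‖tauB T U ν (A k) x‖ ≤ α₁ * (g.len (blk x))⁻¹) →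
      -- NEW: the (3.43)-type Hölder members, derivative (any left letter `D`) on the left, functional `Φ` of the output, anchor `y ∋ p₀`
      ∀ (D : Module.End ℝ (S × ι → ℝ)) (Φ : (S → 𝔸) →ₗ[ℝ] 𝔸) (y : g.Site) (p₀ : S × ι), blk p₀.1 = y →
      ∀ (β Bh cζ : ℝ), 0 ≤ Bh → 0 ≤ cζ →
        (∀ (y' : g.Site) (μ : S × ι → ℝ) (M : ℝ), BlockSupp (g := toB6 g Rr H) (fun p : S × ι => blk p.1) μ y' M →
          ‖Φ ((coordEquiv b).symm (D (Gp μ)))‖ ≤ Bh * g.len y ^ (1 - β) * cζ * Real.exp (-(δ₀ * g.dist y y')) * M) →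
        ∀ (y' : g.Site) (μ : S × ι → ℝ) (M : ℝ), BlockSupp (g := toB6 g Rr H) (fun p : S × ι => blk p.1) μ y' M →
          ‖Φ ((coordEquiv b).symm (D ((gPrimeExtEnd Gp (conj b (vPrimeConc T U g.eta A blk kQ kF sQ sF cfun) * Gp)) μ)))‖ ≤
            B * Bh * g.len y ^ (1 - β) * cζ * Real.exp (-(9 / 10 * δ₀ * g.dist y y')) * M := by
  classical
  obtain ⟨a₁, ha₁, B', hB', HA⟩ := thm34_Gp_uniform b κ d δ₀ BG Cq a₀ d₀ M₂ Λf hBG hCq ha₀ hM₂ hδ₀ hΛf hrepr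
  have hSb : 0 ≤ ∑ i, ‖b i‖ := Finset.sum_nonneg fun i _ => norm_nonneg _
  refine ⟨a₁, ha₁, (∑ i, ‖b i‖) * M₂ * (B' / BG), mul_nonneg (mul_nonneg hSb hM₂) (div_nonneg hB' hBG.le), ?_⟩
  -- NOW the lattice, the background, the data, the Theorems-for-`U` inputs (block and kernel members); then `α₁`, `A` and the `A`-letters
  intro S _ _ T U g _ _ _ Rr H blk kQ sQ cfun w hdnn htri hrefl hsym hlen hlenη hη h261 hST hU1 hd₀B hd₀F hd₀0 hw hcard hkQ hsQ hcfun Δp Gp hΔpGp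
    hGpΔp h342_1 h342_2 h342_3 α₁ hα₁0 hα₁1 A kF sF hkF hsF h337B h337F h337Bτ hA hAτB D Φ y p₀ hp₀ β Bh cζ hBh hcζ hhyp y' μ M hμ
  replace HA := HA T U blk kQ sQ cfun w hdnn htri hrefl hsym hlen hlenη hη h261 hST hU1 hd₀B hd₀F hd₀0 hw hcard hkQ hsQ hcfun hΔpGp hGpΔp h342_1
    h342_2 h342_3
  obtain ⟨-, -, hGpL, -⟩ := HA α₁ hα₁0 hα₁1 A kF sF hkF hsF h337B h337F h337Bτ hA hAτB
  have hc : 0 ≤ Bh * g.len y ^ (1 - β) * cζ := mul_nonneg (mul_nonneg hBh (Real.rpow_nonneg (hlen y).le _)) hcζ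
  have key := norm_probe_transfer b (G := toB6 g Rr H) (fun p : S × ι => blk p.1) (G₁ := Gp) (G₂ := (gPrimeExtEnd Gp (conj b (vPrimeConc T U g.eta A blk kQ kF sQ sF cfun) * Gp)))
    (E₁ := fun a a' => Real.exp (-(δ₀ * g.dist a a'))) (E₂ := fun a a' => Real.exp (-(9 / 10 * δ₀ * g.dist a a')))
    hBG hM₂ (fun a a' => Real.exp_nonneg _) hrepr hGpL D Φ p₀ hc (fun z ν C hν => by
      have h1 := hhyp z ν C hν
      rw [show g.dist y z = g.dist (blk p₀.1) z by rw [hp₀]] at h1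
      simpa only [mul_assoc] using h1) y' μ M hμ
  rw [hp₀] at key
  calc ‖Φ ((coordEquiv b).symm (D ((gPrimeExtEnd Gp (conj b (vPrimeConc T U g.eta A blk kQ kF sQ sF cfun) * Gp)) μ)))‖
      ≤ (∑ i, ‖b i‖) * M₂ * (B' / BG) * (Bh * g.len y ^ (1 - β) * cζ) * Real.exp (-(9 / 10 * δ₀ * g.dist y y')) * M := key
    _ = (∑ i, ‖b i‖) * M₂ * (B' / BG) * Bh * g.len y ^ (1 - β) * cζ * Real.exp (-(9 / 10 * δ₀ * g.dist y y')) * M := by ring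

end HolderU1

section HolderU3

variable {𝔸 : Type*} [NormedRing 𝔸] [NormedAlgebra ℂ 𝔸] [CompleteSpace 𝔸] {ι : Type} [Fintype ι]
variable (b : Module.Basis ι ℝ 𝔸) (κ : Type) [Fintype κ]

set_option maxHeartbeats 1600000 in
/-- **THEOREM 3.4, THE (3.43)-TYPE HÖLDER MEMBER OF `G′(U′U)` WITH THE DERIVATIVE ON THE RIGHT, CONSTANTS BEFORE THE LATTICE** («‖ζG′(U)∇*_Uλ‖_β ≦
B₀(β₀)(Lʲη)^{1−β}(‖ζ‖_β^ξ + |ζ|)e^{−δ₀d(y,y′)}|λ|», (3.43) p. 398; for `U′U`: p. 400; «the constants … do not depend on the sequence {Ω_j}», p. 399):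
`∃ a₁ > 0 ∃ B ≧ 0 ∀ (lattice, background, data, Theorem 3.1 for G′(U) = (Δ′_a(U))⁻¹) ∀ α₁ ≦ a₁ ∀ A ∈ (3.37) ∀ kF sF … ∀` right letter `D` with
`G′(U)·D ≺ B_G Lʲη e^{−δ₀d}` `∀ Φ y p₀ β B_h c_ζ`: IF (a) `‖Φ(G′(U)λ)‖ ≦ B_h(Lʲη)^{2−β}c_ζe^{−δ₀d(y,y′)}|λ|`, (b) `‖Φ(G′(U)∇_kλ)‖ ≦
B_h(Lʲη)^{1−β}c_ζe^{−δ₀d(y,y′)}|λ|` for every concrete `∇_k`, and (c) the same for `D`, THEN `‖Φ(G′(U′U)Dλ)‖ ≦ B·B_h(Lʲη)^{1−β}c_ζ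
e^{−(9δ₀/10)d(y,y′)}|λ|` — FILE 34 `thm34_Gp_holderRight_final` verbatim, re-quantified (the first form of (3.65) on the right letter, gen 9's left
composite applied to `X·G′(U)`, FILE 45's right-entry clause; `θ_L(1) ≦ K` by continuity and `Λ(1/25)` fixed before the lattice;
`B = (Σ_i‖b_i‖)M₂(1 + K·B⁽⁴⁵⁾Λ(1/25)c₁(δ₀, 1/25))`). (R1: [4] Lemma 2.1 (2.61) and the p. 398 scale transfer are hypothesised for the exponents
`9/5000 ≦ α` only — the ones the proof uses — instead of r06's «every 0 < α < 1»; nothing else differs from the r06 original.)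
[cite: Balaban1985BackgroundPropagators, Thm 3.4 p.400 + p.399 + Thm 3.1 (3.42)–(3.43) pp.397–398 + (3.40) p.397 + (3.60)–(3.65) pp.402–403 + p.403 l.1–9; Balaban1984PropagatorsII, (2.51)–(2.55) p.232 + Lemma 2.1 p.234] -/
theorem thm34_Gp_holderRight_uniform [DecidableEq ι] (d : ℕ)
    (δ₀ BG Cq a₀ d₀ M₂ : ℝ) (Λf : ℝ → ℝ)
    (hBG : 0 < BG) (hCq : 0 ≤ Cq) (ha₀ : 0 ≤ a₀) (hM₂ : 0 ≤ M₂) (hδ₀ : 0 < δ₀) (hΛf : ∀ α : ℝ, 0 < α → 1 ≤ Λf α)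
    (hrepr : ∀ (v : 𝔸) (i : ι), |b.repr v i| ≤ M₂ * ‖v‖) :
    ∃ a₁ : ℝ, 0 < a₁ ∧ ∃ B : ℝ, 0 ≤ B ∧
    ∀ {S : Type} [Fintype S] [DecidableEq S] (T : κ → Equiv.Perm S) (U : κ → S → 𝔸ˣ)
      {g : B9.Geometry} [Fintype g.Site] [DecidableEq g.Site] [Nonempty g.Site] {Rr : ℝ} {H : Prop} (blk : S → g.Site)
      (kQ : g.Site → S → 𝔸 →L[ℝ] 𝔸) (sQ : S → 𝔸 →L[ℝ] 𝔸) (cfun w : g.Site → ℝ)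
    -- the multiscale geometry 𝔅 (p. 393, [4] (2.1)–(2.4)) and its axioms
    (hdnn : ∀ a a' : g.Site, 0 ≤ g.dist a a') (htri : Triangle254 (toB6 g Rr H)) (hrefl : ∀ y : g.Site, g.dist y y = 0)
    (hsym : ∀ y y' : g.Site, g.dist y y' = g.dist y' y) (hlen : ∀ y : g.Site, 0 < g.len y) (hlenη : ∀ y : g.Site, g.eta ≤ g.len y)
    (hη : 0 < g.eta)
    -- [4] Lemma 2.1 (2.61) at the rate `δ₀`, for every exponent `9/5000 ≤ α < 1` (R1: the exponents the proof uses; print: «0 < α < 1» with (2.59)), and the p. 398 scale transfer for the same exponents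
    (h261 : ∀ α : ℝ, 9 / 5000 ≤ α → α < 1 → Ineq261 d (toB6 g Rr H) δ₀ α)
      (hST : ∀ α : ℝ, 9 / 5000 ≤ α → ScaleTransfer g δ₀ α (Λf α) (fun a => g.len a) ∧ ScaleTransfer g δ₀ α (Λf α) (fun a => g.len a ^ 2) ∧
        ScaleTransfer g δ₀ α (Λf α) (fun a => (g.len a)⁻¹) ∧ ScaleTransfer g δ₀ α (Λf α) (fun a => (g.len a ^ 2)⁻¹) ∧
        ScaleTransfer g δ₀ α (Λf α) (fun a => (g.len a ^ 4)⁻¹) ∧ ScaleTransfer g δ₀ α (Λf α) (fun y => g.len y ^ (-(4 : ℝ))))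
    (hU1 : ∀ m z, ‖((U m z : 𝔸ˣ) : 𝔸)‖ ≤ 1 ∧ ‖(((U m z)⁻¹ : 𝔸ˣ) : 𝔸)‖ ≤ 1)
    (hd₀B : ∀ μ x, g.dist (blk x) (blk ((T μ).symm x)) ≤ d₀) (hd₀F : ∀ μ x, g.dist (blk x) (blk (T μ x)) ≤ d₀)
    (hd₀0 : ∀ y : g.Site, g.dist y y ≤ d₀)
    -- the `A`-independent data of the concrete `V′(A)` of (3.60)
    (hw : ∀ y, 0 ≤ w y) (hcard : ∀ y, ((B9Eq360Vprime.block blk y).card : ℝ) * w y ≤ 1)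
    (hkQ : ∀ y x, blk x = y → ‖kQ y x‖ ≤ w y) (hsQ : ∀ x, ‖sQ x‖ ≤ 1) (hcfun : ∀ y, |cfun y| ≤ a₀ * (g.len y ^ 2)⁻¹)
    -- THEOREM 3.1 for `G′(U)`: (3.24) `G′(U) = (Δ′_a(U))⁻¹` for the letter `Δ′_a(U)`, and (3.42)₁,₂,₃ at the rate `δ₀`
    {Δp Gp : Module.End ℝ (S × ι → ℝ)} (hΔpGp : Δp * Gp = 1) (hGpΔp : Gp * Δp = 1)
    (h342_1 : HasMajorant (g := toB6 g Rr H) (fun p : S × ι => blk p.1) Gp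
      (fun a a' => BG * g.len a ^ 2 * Real.exp (-(δ₀ * g.dist a a'))))
    (h342_2 : ∀ k : κ ⊕ κ, HasMajorant (g := toB6 g Rr H) (fun p : S × ι => blk p.1)
      (conj b (diffLetter T U ((g.eta : ℂ)⁻¹) k) * Gp) (fun a a' => BG * g.len a * Real.exp (-(δ₀ * g.dist a a'))))
    (h342_3 : ∀ k : κ ⊕ κ, HasMajorant (g := toB6 g Rr H) (fun p : S × ι => blk p.1)
      (Gp * conj b (diffLetter T U ((g.eta : ℂ)⁻¹) k)) (fun a a' => BG * g.len a * Real.exp (-(δ₀ * g.dist a a')))),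
    ∀ (α₁ : ℝ), 0 ≤ α₁ → α₁ ≤ a₁ →
    -- the exponent field `A` in the domain (3.37), read blockwise, and the `A`-dependent (3.59) data `kF`, `sF`
    ∀ (A : κ → S → 𝔸) (kF : g.Site → S → 𝔸 →L[ℝ] 𝔸) (sF : S → 𝔸 →L[ℝ] 𝔸),
      (∀ y x, blk x = y → ‖kF y x‖ ≤ Cq * α₁ * w y) → (∀ x, ‖sF x‖ ≤ Cq * α₁) →
      (∀ ν k x, ‖((g.eta : ℂ)⁻¹) • covDstar T U ν (A k) x‖ ≤ α₁ * (g.len (blk x) ^ 2)⁻¹) →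
      (∀ μ ν x, ‖((g.eta : ℂ)⁻¹) • covD T U μ (A ν) x‖ ≤ α₁ * (g.len (blk x) ^ 2)⁻¹) →
      (∀ μ x, ‖((g.eta : ℂ)⁻¹) • covDstar T U μ (tauB T U μ (A μ)) x‖ ≤ α₁ * (g.len (blk x) ^ 2)⁻¹) →
      (∀ k x, ‖A k x‖ ≤ α₁ * (g.len (blk x))⁻¹) → (∀ ν k x, ‖tauB T U ν (A k) x‖ ≤ α₁ * (g.len (blk x))⁻¹) →
      -- NEW: the (3.43)-type Hölder member with the derivative (any right letter `D` with a (3.42)₃-type entry) on the RIGHT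
      ∀ (D : Module.End ℝ (S × ι → ℝ)),
        HasMajorant (g := toB6 g Rr H) (fun p : S × ι => blk p.1) (Gp * D) (fun a a' => BG * g.len a * Real.exp (-(δ₀ * g.dist a a'))) →
      ∀ (Φ : (S → 𝔸) →ₗ[ℝ] 𝔸) (y : g.Site) (p₀ : S × ι), blk p₀.1 = y →
      ∀ (β Bh cζ : ℝ), 0 ≤ Bh → 0 ≤ cζ →
        -- (a) the Hölder quotient of `ζG′(U)λ` itself (from (3.42)₂ in print; an input here)
        (∀ (y' : g.Site) (μ : S × ι → ℝ) (M : ℝ), BlockSupp (g := toB6 g Rr H) (fun p : S × ι => blk p.1) μ y' M →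
          ‖Φ ((coordEquiv b).symm (Gp μ))‖ ≤ Bh * g.len y ^ (2 - β) * cζ * Real.exp (-(δ₀ * g.dist y y')) * M) →
        -- (b) the member «‖ζG′(U)∇_kλ‖_β» for every concrete difference letter
        (∀ (k : κ ⊕ κ) (y' : g.Site) (μ : S × ι → ℝ) (M : ℝ), BlockSupp (g := toB6 g Rr H) (fun p : S × ι => blk p.1) μ y' M →
          ‖Φ ((coordEquiv b).symm ((Gp * conj b (diffLetter T U ((g.eta : ℂ)⁻¹) k)) μ))‖ ≤
            Bh * g.len y ^ (1 - β) * cζ * Real.exp (-(δ₀ * g.dist y y')) * M) →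
        -- (c) the member for the right letter `D`
        (∀ (y' : g.Site) (μ : S × ι → ℝ) (M : ℝ), BlockSupp (g := toB6 g Rr H) (fun p : S × ι => blk p.1) μ y' M →
          ‖Φ ((coordEquiv b).symm ((Gp * D) μ))‖ ≤ Bh * g.len y ^ (1 - β) * cζ * Real.exp (-(δ₀ * g.dist y y')) * M) →
        ∀ (y' : g.Site) (μ : S × ι → ℝ) (M : ℝ), BlockSupp (g := toB6 g Rr H) (fun p : S × ι => blk p.1) μ y' M →
          ‖Φ ((coordEquiv b).symm (((gPrimeExtEnd Gp (conj b (vPrimeConc T U g.eta A blk kQ kF sQ sF cfun) * Gp)) * D) μ))‖ ≤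
            B * Bh * g.len y ^ (1 - β) * cζ * Real.exp (-(9 / 10 * δ₀ * g.dist y y')) * M := by
  classical
  -- the scale-transfer constants of the chain, READ FROM THE GIVEN FUNCTION `Λf` (lattice-free)
  have hΛ : 1 ≤ Λf (1 / 100) := hΛf _ (by norm_num)
  have hΛ'1 : 1 ≤ Λf (1 / 25) := hΛf _ (by norm_num)
  obtain ⟨a₁, ha₁, B', hB', HA⟩ := thm34_Gp_uniform b κ d δ₀ BG Cq a₀ d₀ M₂ Λf hBG hCq ha₀ hM₂ hδ₀ hΛf hrepr
  have hSb : 0 ≤ ∑ i, ‖b i‖ := Finset.sum_nonneg fun i _ => norm_nonneg _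
  have hΛ0 : 0 ≤ (Λf (1 / 100)) := zero_le_one.trans hΛ
  have hΛ'0 : 0 ≤ (Λf (1 / 25)) := zero_le_one.trans hΛ'1
  have hc1' : 0 ≤ B6.c1 d δ₀ (1 / 25) := B6RandomWalk.c1_nonneg d δ₀ (1 / 25)
  -- «for α₁ sufficiently small»: the unit-normalised `θ_L(1)` is continuous at `α₁ = 0`, hence bounded below a threshold
  obtain ⟨K, ε, hK, hε, hKb⟩ := exists_bound_of_continuousAt
    (f := fun α₁ : ℝ => thetaL363 (Fintype.card κ) 1 α₁ a₀ Cq M₂ (∑ i, ‖b i‖) (Real.exp (δ₀ * d₀)) 1 (Λf (1 / 100)) (B6.c1 d δ₀ (1 / 100)))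
    (by unfold thetaL363 kappa385 cVConc cBConc; fun_prop)
  have hBfin : 0 ≤ (∑ i, ‖b i‖) * M₂ * (1 + K * B' * (Λf (1 / 25)) * B6.c1 d δ₀ (1 / 25)) :=
    mul_nonneg (mul_nonneg hSb hM₂) (by positivity)
  refine ⟨min (min a₁ (1 / 4)) (ε / 2), lt_min (lt_min ha₁ (by norm_num)) (half_pos hε),
    (∑ i, ‖b i‖) * M₂ * (1 + K * B' * (Λf (1 / 25)) * B6.c1 d δ₀ (1 / 25)), hBfin, ?_⟩
  -- NOW the lattice, the background, the data, the Theorems-for-`U` inputs (block and kernel members); then `α₁`, `A` and the `A`-letters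
  intro S _ _ T U g _ _ _ Rr H blk kQ sQ cfun w hdnn htri hrefl hsym hlen hlenη hη h261 hST hU1 hd₀B hd₀F hd₀0 hw hcard hkQ hsQ hcfun Δp Gp hΔpGp
    hGpΔp h342_1 h342_2 h342_3 α₁ hα₁0 hα₁1 A kF sF hkF hsF h337B h337F h337Bτ hA hAτB D hGpD Φ y p₀ hp₀ β Bh cζ hBh hcζ h0 hR hD y' μ M hμ
  obtain ⟨y₀⟩ := ‹Nonempty g.Site›
  replace HA := HA T U blk kQ sQ cfun w hdnn htri hrefl hsym hlen hlenη hη h261 hST hU1 hd₀B hd₀F hd₀0 hw hcard hkQ hsQ hcfun hΔpGp hGpΔp h342_1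
    h342_2 h342_3
  -- the p. 398 scale transfers and [4] Lemma 2.1 at the exponents `1/100` (gen 9's left composite) and `1/25` (the final composition)
  obtain ⟨-, -, hT1i, hT2i, -, -⟩ := hST (1 / 100) (by norm_num)
  obtain ⟨hT1', -, -, -, -, -⟩ := hST (1 / 25) (by norm_num)
  have h261β : Ineq261 d (toB6 g Rr H) δ₀ (1 / 100) := h261 _ (by norm_num) (by norm_num)
  have h261' : Ineq261 d (toB6 g Rr H) δ₀ (1 / 25) := h261 _ (by norm_num) (by norm_num)
  have hα₁a : α₁ ≤ a₁ := hα₁1.trans ((min_le_left _ _).trans (min_le_left _ _))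
  have hα₁q : α₁ ≤ 1 / 4 := hα₁1.trans ((min_le_left _ _).trans (min_le_right _ _))
  have hα₁ε : |α₁| < ε := by rw [abs_of_nonneg hα₁0]; linarith only [hα₁1, min_le_right (min a₁ (1 / 4)) (ε / 2), hε]
  obtain ⟨i1, -, -, hGpR⟩ := HA α₁ hα₁0 hα₁a A kF sF hkF hsF h337B h337F h337Bτ hA hAτB
  -- names
  set V : Module.End ℝ (S × ι → ℝ) := (conj b (vPrimeConc T U g.eta A blk kQ kF sQ sF cfun)) with hVdef
  set E : Module.End ℝ (S × ι → ℝ) := (gPrimeExtEnd Gp (conj b (vPrimeConc T U g.eta A blk kQ kF sQ sF cfun) * Gp)) with hEdef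
  -- (3.65)₁ from the two-sided inverse: `E = G′ + G′V′E`, read on the right letter `D`
  have hE : E = Gp + Gp * V * E := by
    have e1 : Gp * ((Δp - V) * E) = Gp := by rw [i1, mul_one]
    have e2 : Gp * ((Δp - V) * E) = E - Gp * V * E := by
      rw [sub_mul, mul_sub, ← mul_assoc, hGpΔp, one_mul, mul_assoc]
    rw [e2] at e1
    exact (sub_eq_iff_eq_add.mp e1)
  have hED : E * D = Gp * D + Gp * V * (E * D) := by
    conv_lhs => rw [hE]
    rw [add_mul]
    simp only [mul_assoc]
  -- the anchor: from now on `y` is the block of `p₀`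
  subst hp₀
  -- the constant of the point-probe composite and the two rescalings of the printed weights
  have hℓ : 0 < g.len (blk p₀.1) := hlen _
  set B₀' : ℝ := M₂ * (Bh * g.len (blk p₀.1) ^ (1 - β) * cζ) * (g.len (blk p₀.1))⁻¹ with hB₀'def
  have hB₀'0 : 0 ≤ B₀' := mul_nonneg (mul_nonneg hM₂ (mul_nonneg (mul_nonneg hBh (Real.rpow_nonneg hℓ.le _)) hcζ)) (inv_nonneg.mpr hℓ.le)
  have hpow : g.len (blk p₀.1) ^ (2 - β) = g.len (blk p₀.1) ^ (1 - β) * g.len (blk p₀.1) := by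
    rw [show (2 : ℝ) - β = (1 - β) + 1 by ring, Real.rpow_add hℓ, Real.rpow_one]
  have hB1 : B₀' * g.len (blk p₀.1) = M₂ * (Bh * g.len (blk p₀.1) ^ (1 - β) * cζ) := by
    rw [hB₀'def]; field_simp
  have hB2 : B₀' * g.len (blk p₀.1) ^ 2 = M₂ * (Bh * g.len (blk p₀.1) ^ (2 - β) * cζ) := by
    rw [hpow, hB₀'def]; field_simp
  -- the exponential weights are nonnegative
  have hE₀ : ∀ a a' : g.Site, 0 ≤ Real.exp (-(δ₀ * g.dist a a')) := fun a a' => Real.exp_nonneg _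
  -- per real coordinate `i` of `Φ`: the point probe `Xᵢ` and the three majorants of `Xᵢ·G′(U)`, `Xᵢ·G′(U)∇_k`, `Xᵢ·G′(U)D`
  have hcoord : ∀ i : ι,
      |((b.coord i) ∘ₗ Φ ∘ₗ (coordEquiv (S := S) b).symm.toLinearMap) ((E * D) μ)| ≤
        (B₀' * (1 + K * B' * (Λf (1 / 25)) * B6.c1 d δ₀ (1 / 25))) * g.len (blk p₀.1) * Real.exp (-(9 / 10 * δ₀ * g.dist (blk p₀.1) y')) * M := by
    intro i
    set X : Module.End ℝ (S × ι → ℝ) :=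
      (LinearMap.single ℝ (fun _ : S × ι => ℝ) p₀) ∘ₗ ((b.coord i) ∘ₗ Φ ∘ₗ (coordEquiv (S := S) b).symm.toLinearMap) with hXdef
    -- (a) ⇒ `X·G′ ≺ B₀′(Lʲη)²e^{−δ₀d}`
    have hX1 : HasMajorant (g := toB6 g Rr H) (fun p : S × ι => blk p.1) (X * Gp)
        (fun a a' => B₀' * g.len a ^ 2 * Real.exp (-(δ₀ * g.dist a a'))) := by
      refine hasMajorant_pointProbe_mul (G := toB6 g Rr H) (fun p : S × ι => blk p.1) p₀ _ Gp _
        (fun a a' => mul_nonneg (mul_nonneg hB₀'0 (sq_nonneg _)) (hE₀ a a')) fun z ν C hν => ?_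
      rw [coordProbe_apply]
      calc |b.repr (Φ ((coordEquiv b).symm (Gp ν))) i| ≤ M₂ * ‖Φ ((coordEquiv b).symm (Gp ν))‖ := hrepr _ _
        _ ≤ M₂ * (Bh * g.len (blk p₀.1) ^ (2 - β) * cζ * Real.exp (-(δ₀ * g.dist (blk p₀.1) z)) * C) :=
            mul_le_mul_of_nonneg_left (h0 z ν C hν) hM₂
        _ = B₀' * g.len (blk p₀.1) ^ 2 * Real.exp (-(δ₀ * g.dist (blk p₀.1) z)) * C := by rw [hB2]; ring
    -- (b) ⇒ `X·G′∇_k ≺ B₀′Lʲη e^{−δ₀d}`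
    have hX3 : ∀ k : κ ⊕ κ, HasMajorant (g := toB6 g Rr H) (fun p : S × ι => blk p.1) (X * Gp * conj b (diffLetter T U ((g.eta : ℂ)⁻¹) k))
        (fun a a' => B₀' * g.len a * Real.exp (-(δ₀ * g.dist a a'))) := by
      intro k
      rw [mul_assoc]
      refine hasMajorant_pointProbe_mul (G := toB6 g Rr H) (fun p : S × ι => blk p.1) p₀ _ _ _
        (fun a a' => mul_nonneg (mul_nonneg hB₀'0 (hlen a).le) (hE₀ a a')) fun z ν C hν => ?_
      rw [coordProbe_apply]
      calc |b.repr (Φ ((coordEquiv b).symm ((Gp * conj b (diffLetter T U ((g.eta : ℂ)⁻¹) k)) ν))) i|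
          ≤ M₂ * ‖Φ ((coordEquiv b).symm ((Gp * conj b (diffLetter T U ((g.eta : ℂ)⁻¹) k)) ν))‖ := hrepr _ _
        _ ≤ M₂ * (Bh * g.len (blk p₀.1) ^ (1 - β) * cζ * Real.exp (-(δ₀ * g.dist (blk p₀.1) z)) * C) :=
            mul_le_mul_of_nonneg_left (hR k z ν C hν) hM₂
        _ = B₀' * g.len (blk p₀.1) * Real.exp (-(δ₀ * g.dist (blk p₀.1) z)) * C := by rw [hB1]; ring
    -- (c) ⇒ `X·G′D ≺ B₀′Lʲη e^{−δ₀d}`, rate weakened to `9δ₀/10`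
    have hXD : HasMajorant (g := toB6 g Rr H) (fun p : S × ι => blk p.1) (X * (Gp * D))
        (fun a a' => B₀' * g.len a * Real.exp (-(9 / 10 * δ₀ * g.dist a a'))) := by
      refine hasMajorant_rate_mono (R := Rr) (H := H) (r := δ₀) (fun p : S × ι => blk p.1) B₀' (fun a => g.len a) hB₀'0 (fun a => (hlen a).le)
        (by linarith only [hδ₀]) hdnn ?_
      refine hasMajorant_pointProbe_mul (G := toB6 g Rr H) (fun p : S × ι => blk p.1) p₀ _ _ _
        (fun a a' => mul_nonneg (mul_nonneg hB₀'0 (hlen a).le) (hE₀ a a')) fun z ν C hν => ?_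
      rw [coordProbe_apply]
      calc |b.repr (Φ ((coordEquiv b).symm ((Gp * D) ν))) i| ≤ M₂ * ‖Φ ((coordEquiv b).symm ((Gp * D) ν))‖ := hrepr _ _
        _ ≤ M₂ * (Bh * g.len (blk p₀.1) ^ (1 - β) * cζ * Real.exp (-(δ₀ * g.dist (blk p₀.1) z)) * C) :=
            mul_le_mul_of_nonneg_left (hD z ν C hν) hM₂
        _ = B₀' * g.len (blk p₀.1) * Real.exp (-(δ₀ * g.dist (blk p₀.1) z)) * C := by rw [hB1]; ring
    -- gen 9's LEFT COMPOSITE for the operator `X·G′(U)`: `(X·G′)·V′ ≺ θ_L(B₀′)e^{−(49δ₀/50)d}`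
    have hsmall : ∀ z : g.Site, g.eta * (α₁ * (g.len z)⁻¹) ≤ 1 / 4 := fun z => by
      have hq : g.eta * (g.len z)⁻¹ ≤ 1 := by
        rw [← div_eq_mul_inv]; exact (div_le_one (hlen z)).mpr (hlenη z)
      calc g.eta * (α₁ * (g.len z)⁻¹) = α₁ * (g.eta * (g.len z)⁻¹) := by ring
        _ ≤ α₁ * 1 := mul_le_mul_of_nonneg_left hq hα₁0
        _ ≤ 1 / 4 := by linarith only [hα₁q]
    have hA' : ∀ m x, ‖A m x‖ ≤ α₁ * (g.len (blk x))⁻¹ ∧ ‖tauB T U m (A m) x‖ ≤ α₁ * (g.len (blk x))⁻¹ :=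
      fun m x => ⟨hA m x, hAτB m m x⟩
    have h337s' : ∀ m x, ‖((g.eta : ℂ)⁻¹) • covDstar T U m (A m) x‖ ≤ α₁ * (g.len (blk x) ^ 2)⁻¹ := fun m x => h337B m m x
    have h337F' : ∀ m x, ‖((g.eta : ℂ)⁻¹) • covD T U m (A m) x‖ ≤ α₁ * (g.len (blk x) ^ 2)⁻¹ := fun m x => h337F m m x
    have hd₀' : ∀ m x, g.dist (blk x) (blk (T m x)) ≤ d₀ ∧ g.dist (blk x) (blk ((T m).symm x)) ≤ d₀ :=
      fun m x => ⟨hd₀F m x, hd₀B m x⟩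
    have hrc1 : 49 / 50 * δ₀ + (1 / 100 + 1 / 100) * δ₀ ≤ δ₀ := by linarith only [hδ₀]
    have hXV := hasMajorant_gp_vPrime (Rr := Rr) (H := H) b T U blk d hη A kQ kF sQ sF cfun w 1 d₀ M₂ Cq a₀ δ₀ δ₀ (1 / 100) (1 / 100)
      (49 / 50 * δ₀) (Λf (1 / 100)) B₀' α₁ hB₀'0 hα₁0 hΛ0 (by linarith only [hδ₀]) (by norm_num) (by norm_num) hδ₀.le hδ₀.le hrc1 hdnn htri hlen
      h261β hT1i hT2i hM₂ hrepr hsmall hA' h337s' h337F' h337Bτ hU1 hd₀' hd₀0 hw hcard hCq ha₀ hkQ hkF hsQ hsF hcfun hX1 hX3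
    rw [thetaL363_linear] at hXV
    -- `θ_L(1) ≦ K` below the threshold
    have hθK : thetaL363 (Fintype.card κ) 1 α₁ a₀ Cq M₂ (∑ i, ‖b i‖) (Real.exp (δ₀ * d₀)) 1 (Λf (1 / 100)) (B6.c1 d δ₀ (1 / 100)) ≤ K := hKb α₁ hα₁ε
    have hθ0 : 0 ≤ thetaL363 (Fintype.card κ) 1 α₁ a₀ Cq M₂ (∑ i, ‖b i‖) (Real.exp (δ₀ * d₀)) 1 (Λf (1 / 100)) (B6.c1 d δ₀ (1 / 100)) :=
      thetaL363_nonneg hα₁0 ha₀ hCq hM₂ hSb (Real.exp_nonneg _) zero_le_one hΛ0 (B6RandomWalk.c1_nonneg d δ₀ (1 / 100))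
    -- FILE 26's right entry `E·D ≺ B₂₆Lʲη e^{−(9δ₀/10)d}` and the composition [4] (2.52)–(2.55) + Lemma 2.1 at `1/25`
    have hT₂ := hGpR D hGpD
    have hr' : 9 / 10 * δ₀ + (1 / 25 + 1 / 25) * δ₀ ≤ 49 / 50 * δ₀ := by linarith only [hδ₀]
    have hcomp := hasMajorant_comp_decay_left1 (R := Rr) (H := H) (fun p : S × ι => blk p.1) d δ₀ (1 / 25) (1 / 25) (9 / 10 * δ₀) (49 / 50 * δ₀) (Λf (1 / 25))
      (B₀' * thetaL363 (Fintype.card κ) 1 α₁ a₀ Cq M₂ (∑ i, ‖b i‖) (Real.exp (δ₀ * d₀)) 1 (Λf (1 / 100)) (B6.c1 d δ₀ (1 / 100))) B'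
      (fun a => g.len a) (fun a => (hlen a).le) hΛ'0 (mul_nonneg hB₀'0 hθ0) hB' (by linarith only [hδ₀]) hr' hdnn htri hT1' h261'
      hXV hT₂
    -- sum of the two pieces: `X·(E·D) = X·(G′D) + (X·G′·V′)·(E·D)`
    have hsplit : X * (E * D) = X * (Gp * D) + X * Gp * V * (E * D) := by
      conv_lhs => rw [hED]
      rw [mul_add]
      simp only [mul_assoc]
    have hsum := hasMajorant_add (g := toB6 g Rr H) (fun p : S × ι => blk p.1) hXD hcomp
    rw [← hsplit] at hsum
    have hfin : HasMajorant (g := toB6 g Rr H) (fun p : S × ι => blk p.1) (X * (E * D))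
        (fun a a' => (B₀' * (1 + K * B' * (Λf (1 / 25)) * B6.c1 d δ₀ (1 / 25))) * g.len a * Real.exp (-(9 / 10 * δ₀ * g.dist a a'))) := by
      refine hasMajorant_mono (g := toB6 g Rr H) _ hsum fun a a' => ?_
      have hw' : 0 ≤ g.len a * Real.exp (-(9 / 10 * δ₀ * g.dist a a')) := mul_nonneg (hlen a).le (Real.exp_nonneg _)
      have hθle : B₀' * thetaL363 (Fintype.card κ) 1 α₁ a₀ Cq M₂ (∑ i, ‖b i‖) (Real.exp (δ₀ * d₀)) 1 (Λf (1 / 100)) (B6.c1 d δ₀ (1 / 100)) * B' * (Λf (1 / 25)) *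
          B6.c1 d δ₀ (1 / 25) ≤ B₀' * K * B' * (Λf (1 / 25)) * B6.c1 d δ₀ (1 / 25) :=
        mul_le_mul_of_nonneg_right (mul_le_mul_of_nonneg_right (mul_le_mul_of_nonneg_right
          (mul_le_mul_of_nonneg_left hθK hB₀'0) hB') hΛ'0) hc1'
      calc B₀' * g.len a * Real.exp (-(9 / 10 * δ₀ * g.dist a a')) +
            B₀' * thetaL363 (Fintype.card κ) 1 α₁ a₀ Cq M₂ (∑ i, ‖b i‖) (Real.exp (δ₀ * d₀)) 1 (Λf (1 / 100)) (B6.c1 d δ₀ (1 / 100)) * B' * (Λf (1 / 25)) *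
              B6.c1 d δ₀ (1 / 25) * g.len a * Real.exp (-(9 / 10 * δ₀ * g.dist a a'))
          = (B₀' + B₀' * thetaL363 (Fintype.card κ) 1 α₁ a₀ Cq M₂ (∑ i, ‖b i‖) (Real.exp (δ₀ * d₀)) 1 (Λf (1 / 100)) (B6.c1 d δ₀ (1 / 100)) * B' * (Λf (1 / 25)) *
              B6.c1 d δ₀ (1 / 25)) * (g.len a * Real.exp (-(9 / 10 * δ₀ * g.dist a a'))) := by ring
        _ ≤ (B₀' + B₀' * K * B' * (Λf (1 / 25)) * B6.c1 d δ₀ (1 / 25)) * (g.len a * Real.exp (-(9 / 10 * δ₀ * g.dist a a'))) :=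
            mul_le_mul_of_nonneg_right (add_le_add le_rfl hθle) hw'
        _ = (B₀' * (1 + K * B' * (Λf (1 / 25)) * B6.c1 d δ₀ (1 / 25))) * g.len a * Real.exp (-(9 / 10 * δ₀ * g.dist a a')) := by ring
    have hread := probe_le_of_hasMajorant_pointProbe_mul (G := toB6 g Rr H) (fun p : S × ι => blk p.1) p₀
      ((b.coord i) ∘ₗ Φ ∘ₗ (coordEquiv (S := S) b).symm.toLinearMap) (E * D) _ hfin y' μ M hμ
    simpa only [coordProbe_apply] using hread
  -- from the coordinates to the norm
  have hn := norm_le_sum_norm_mul_of_repr_le b (Φ ((coordEquiv b).symm ((E * D) μ))) _ (fun i => by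
    simpa only [coordProbe_apply] using hcoord i)
  calc ‖Φ ((coordEquiv b).symm ((E * D) μ))‖
      ≤ (∑ i, ‖b i‖) * ((B₀' * (1 + K * B' * (Λf (1 / 25)) * B6.c1 d δ₀ (1 / 25))) * g.len (blk p₀.1) *
          Real.exp (-(9 / 10 * δ₀ * g.dist (blk p₀.1) y')) * M) := hn
    _ = (∑ i, ‖b i‖) * M₂ * (1 + K * B' * (Λf (1 / 25)) * B6.c1 d δ₀ (1 / 25)) * Bh * g.len (blk p₀.1) ^ (1 - β) * cζ *
          Real.exp (-(9 / 10 * δ₀ * g.dist (blk p₀.1) y')) * M := by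
        have e : (∑ i, ‖b i‖) * ((B₀' * (1 + K * B' * (Λf (1 / 25)) * B6.c1 d δ₀ (1 / 25))) * g.len (blk p₀.1) *
            Real.exp (-(9 / 10 * δ₀ * g.dist (blk p₀.1) y')) * M) =
            (∑ i, ‖b i‖) * (1 + K * B' * (Λf (1 / 25)) * B6.c1 d δ₀ (1 / 25)) * (B₀' * g.len (blk p₀.1)) *
            Real.exp (-(9 / 10 * δ₀ * g.dist (blk p₀.1) y')) * M := by ring
        rw [e, hB1]; ring

end HolderU3

section HolderInputGpU1

variable {𝔸 : Type*} [NormedRing 𝔸] [NormedAlgebra ℂ 𝔸] [CompleteSpace 𝔸] {ι : Type} [Fintype ι]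
variable (b : Module.Basis ι ℝ 𝔸) (κ : Type) [Fintype κ]

set_option maxHeartbeats 1600000 in
/-- **THEOREM 3.4 × THEOREM 3.1: THE MEMBERS (3.44) AND (3.45) (MIXED SECOND DIFFERENCES, INPUT HÖLDER NORM) FOR THE CONCRETE `G′(U′U)` OF
(3.64), THE CONSTANTS CHOSEN BEFORE THE LATTICE** («|(∇_UG′(U)∇*_Uλ)(x)| ≦ B′₀(ε)(…)e^{−δ₀d(y,y′)}» (3.44) and its Hölder-output twin (3.45),
p. 398; for `U′U` by Theorem 3.4 p. 400 and p. 403 l. 1–9; «the constants … do not depend on the sequence {Ω_j}», p. 399): `∃ a₁ > 0 ∃ B ≧ 0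
∀ (lattice 𝔅 = g, background U, data, Theorem 3.1 for G′(U) = (Δ′_a(U))⁻¹) ∀ α₁ ≦ a₁ ∀ A kF sF …`: (i) `G′(U′U) := gPrimeExtEnd G′(U) (V′(A)G′(U))` is
the two-sided inverse of `Δ′_a(U) − V′(A)` ∧, for every left letter `D_l` (`D_lG′(U) ≺ B_GLʲηe^{−δ₀d}`), right letter `D_s` (`G′(U)D_s ≺
B_GLʲηe^{−δ₀d}`), block-supported `λ` (`|λ| ≦ M`) and `N ≧ 0` with `|(∇_kG′(U)D_sλ)(z)| ≦ Ne^{−δ₀d(y_z,y′)}`: (v′) `|(D_lG′(U)D_sλ)(z)| ≦ Ne^{−δ₀d}` ⟹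
`|(D_lG′(U′U)D_sλ)(x)| ≦ B(N + M)e^{−(4δ₀/5)d(y_x,y′)}`; (vi′) for every `ℝ`-linear `𝔸`-valued `Φ` anchored at `y ∋ p₀`, `γ`, `B_h, c_ζ ≧ 0` with the
(3.43)-left datum for `U` and every `N₂ ≧ 0` with `‖Φ(D_lG′(U)D_sλ)‖ ≦ N₂e^{−δ₀d(y,y′)}`: `‖Φ(D_lG′(U′U)D_sλ)‖ ≦ B(N₂ + B_h(Lʲη)^{1−γ}c_ζ(Lʲη)⁻¹(N +
M))e^{−(4δ₀/5)d(y,y′)}` — FILE 38 `thm34_Gp_holderInput_final` verbatim, re-quantified. (R1: [4] Lemma 2.1 (2.61) and the p. 398 scale transfer are hypothesised for the exponents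
`9/5000 ≦ α` only — the ones the proof uses — instead of r06's «every 0 < α < 1»; nothing else differs from the r06 original.)
[cite: Balaban1985BackgroundPropagators, Thm 3.4 p.400 + p.399 + Thm 3.1 (3.42)–(3.45) pp.397–398 + (3.60)–(3.65) p.402 + p.403 l.1–9 + (3.37) p.396; Balaban1984PropagatorsII, (2.51)–(2.55) p.232 + Lemma 2.1 p.234] -/
theorem thm34_Gp_holderInput_uniform [DecidableEq ι] (d : ℕ)
    (δ₀ BG Cq a₀ d₀ M₂ : ℝ) (Λf : ℝ → ℝ)
    (hBG : 0 < BG) (hCq : 0 ≤ Cq) (ha₀ : 0 ≤ a₀) (hM₂ : 0 ≤ M₂) (hδ₀ : 0 < δ₀) (hΛf : ∀ α : ℝ, 0 < α → 1 ≤ Λf α)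
    (hrepr : ∀ (v : 𝔸) (i : ι), |b.repr v i| ≤ M₂ * ‖v‖) :
    ∃ a₁ : ℝ, 0 < a₁ ∧ ∃ B : ℝ, 0 ≤ B ∧
    ∀ {S : Type} [Fintype S] [DecidableEq S] (T : κ → Equiv.Perm S) (U : κ → S → 𝔸ˣ)
      {g : B9.Geometry} [Fintype g.Site] [DecidableEq g.Site] [Nonempty g.Site] {Rr : ℝ} {H : Prop} (blk : S → g.Site)
      (kQ : g.Site → S → 𝔸 →L[ℝ] 𝔸) (sQ : S → 𝔸 →L[ℝ] 𝔸) (cfun w : g.Site → ℝ)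
    -- the multiscale geometry 𝔅 (p. 393, [4] (2.1)–(2.4)) and its axioms
    (hdnn : ∀ a a' : g.Site, 0 ≤ g.dist a a') (htri : Triangle254 (toB6 g Rr H)) (hrefl : ∀ y : g.Site, g.dist y y = 0)
    (hsym : ∀ y y' : g.Site, g.dist y y' = g.dist y' y) (hlen : ∀ y : g.Site, 0 < g.len y) (hlenη : ∀ y : g.Site, g.eta ≤ g.len y)
    (hη : 0 < g.eta)
    -- [4] Lemma 2.1 (2.61) at the rate `δ₀`, for every exponent `9/5000 ≤ α < 1` (R1: the exponents the proof uses; print: «0 < α < 1» with (2.59)), and the p. 398 scale transfer for the same exponents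
    (h261 : ∀ α : ℝ, 9 / 5000 ≤ α → α < 1 → Ineq261 d (toB6 g Rr H) δ₀ α)
      (hST : ∀ α : ℝ, 9 / 5000 ≤ α → ScaleTransfer g δ₀ α (Λf α) (fun a => g.len a) ∧ ScaleTransfer g δ₀ α (Λf α) (fun a => g.len a ^ 2) ∧
        ScaleTransfer g δ₀ α (Λf α) (fun a => (g.len a)⁻¹) ∧ ScaleTransfer g δ₀ α (Λf α) (fun a => (g.len a ^ 2)⁻¹) ∧
        ScaleTransfer g δ₀ α (Λf α) (fun a => (g.len a ^ 4)⁻¹) ∧ ScaleTransfer g δ₀ α (Λf α) (fun y => g.len y ^ (-(4 : ℝ))))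
    (hU1 : ∀ m z, ‖((U m z : 𝔸ˣ) : 𝔸)‖ ≤ 1 ∧ ‖(((U m z)⁻¹ : 𝔸ˣ) : 𝔸)‖ ≤ 1)
    (hd₀B : ∀ μ x, g.dist (blk x) (blk ((T μ).symm x)) ≤ d₀) (hd₀F : ∀ μ x, g.dist (blk x) (blk (T μ x)) ≤ d₀)
    (hd₀0 : ∀ y : g.Site, g.dist y y ≤ d₀)
    -- the `A`-independent data of the concrete `V′(A)` of (3.60)
    (hw : ∀ y, 0 ≤ w y) (hcard : ∀ y, ((B9Eq360Vprime.block blk y).card : ℝ) * w y ≤ 1)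
    (hkQ : ∀ y x, blk x = y → ‖kQ y x‖ ≤ w y) (hsQ : ∀ x, ‖sQ x‖ ≤ 1) (hcfun : ∀ y, |cfun y| ≤ a₀ * (g.len y ^ 2)⁻¹)
    -- THEOREM 3.1 for `G′(U)`: (3.24) `G′(U) = (Δ′_a(U))⁻¹` for the letter `Δ′_a(U)`, and (3.42)₁,₂,₃ at the rate `δ₀`
    {Δp Gp : Module.End ℝ (S × ι → ℝ)} (hΔpGp : Δp * Gp = 1) (hGpΔp : Gp * Δp = 1)
    (h342_1 : HasMajorant (g := toB6 g Rr H) (fun p : S × ι => blk p.1) Gp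
      (fun a a' => BG * g.len a ^ 2 * Real.exp (-(δ₀ * g.dist a a'))))
    (h342_2 : ∀ k : κ ⊕ κ, HasMajorant (g := toB6 g Rr H) (fun p : S × ι => blk p.1)
      (conj b (diffLetter T U ((g.eta : ℂ)⁻¹) k) * Gp) (fun a a' => BG * g.len a * Real.exp (-(δ₀ * g.dist a a'))))
    (h342_3 : ∀ k : κ ⊕ κ, HasMajorant (g := toB6 g Rr H) (fun p : S × ι => blk p.1)
      (Gp * conj b (diffLetter T U ((g.eta : ℂ)⁻¹) k)) (fun a a' => BG * g.len a * Real.exp (-(δ₀ * g.dist a a')))),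
    ∀ (α₁ : ℝ), 0 ≤ α₁ → α₁ ≤ a₁ →
    -- the exponent field `A` in the domain (3.37), read blockwise, and the `A`-dependent (3.59) data `kF`, `sF`
    ∀ (A : κ → S → 𝔸) (kF : g.Site → S → 𝔸 →L[ℝ] 𝔸) (sF : S → 𝔸 →L[ℝ] 𝔸),
      (∀ y x, blk x = y → ‖kF y x‖ ≤ Cq * α₁ * w y) → (∀ x, ‖sF x‖ ≤ Cq * α₁) →
      (∀ ν k x, ‖((g.eta : ℂ)⁻¹) • covDstar T U ν (A k) x‖ ≤ α₁ * (g.len (blk x) ^ 2)⁻¹) →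
      (∀ μ ν x, ‖((g.eta : ℂ)⁻¹) • covD T U μ (A ν) x‖ ≤ α₁ * (g.len (blk x) ^ 2)⁻¹) →
      (∀ μ x, ‖((g.eta : ℂ)⁻¹) • covDstar T U μ (tauB T U μ (A μ)) x‖ ≤ α₁ * (g.len (blk x) ^ 2)⁻¹) →
      (∀ k x, ‖A k x‖ ≤ α₁ * (g.len (blk x))⁻¹) → (∀ ν k x, ‖tauB T U ν (A k) x‖ ≤ α₁ * (g.len (blk x))⁻¹) →
      -- (i) `G′(U′U)` = the two-sided inverse of `Δ′_a(U) − V′(A)` (FILE 26, re-exported)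
      (Δp - (conj b (vPrimeConc T U g.eta A blk kQ kF sQ sF cfun))) * (gPrimeExtEnd Gp (conj b (vPrimeConc T U g.eta A blk kQ kF sQ sF cfun) * Gp)) = 1 ∧
      (gPrimeExtEnd Gp (conj b (vPrimeConc T U g.eta A blk kQ kF sQ sF cfun) * Gp)) * (Δp - (conj b (vPrimeConc T U g.eta A blk kQ kF sQ sF cfun))) = 1 ∧
      -- (v′) NEW: Theorem 3.1's (3.44)-type member (input Hölder norm, sup output) of `G′(U′U)`, for every pair of letters `D_l` (left, with the
      -- (3.42)₂-type entry `D_lG′(U) ≺ B_GLʲηe^{−δ₀d}`) and `D_s` (right, with the (3.42)₃-type entry `G′(U)D_s ≺ B_GLʲηe^{−δ₀d}`)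
      (∀ (Dl Ds : Module.End ℝ (S × ι → ℝ)),
        HasMajorant (g := toB6 g Rr H) (fun p : S × ι => blk p.1) (Dl * Gp) (fun a a' => BG * g.len a * Real.exp (-(δ₀ * g.dist a a'))) →
        HasMajorant (g := toB6 g Rr H) (fun p : S × ι => blk p.1) (Gp * Ds) (fun a a' => BG * g.len a * Real.exp (-(δ₀ * g.dist a a'))) →
      ∀ (y' : g.Site) (μ : S × ι → ℝ) (M : ℝ), BlockSupp (g := toB6 g Rr H) (fun p : S × ι => blk p.1) μ y' M →
      ∀ (N : ℝ), 0 ≤ N →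
        -- (3.44) FOR `U`, THIS INPUT: the mixed second differences of `G′(U)λ` (in print `N = B′₀(ε)(‖λ‖_ε^{ξ′}(L^{j′}η)^ε + |λ|)`)
        (∀ (k : κ ⊕ κ) (z : S × ι), |(((conj b (diffLetter T U ((g.eta : ℂ)⁻¹) k)) * Gp * Ds) μ) z| ≤ N * Real.exp (-(δ₀ * g.dist (blk z.1) y'))) →
        (∀ z : S × ι, |((Dl * Gp * Ds) μ) z| ≤ N * Real.exp (-(δ₀ * g.dist (blk z.1) y'))) →
        ∀ x : S × ι, |((Dl * (gPrimeExtEnd Gp (conj b (vPrimeConc T U g.eta A blk kQ kF sQ sF cfun) * Gp)) * Ds) μ) x| ≤ B * (N + M) * Real.exp (-(4 / 5 * δ₀ * g.dist (blk x.1) y'))) ∧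
      -- (vi′) NEW: Theorem 3.1's (3.45)-type member (input Hölder norm, Hölder output through a transported quotient functional `Φ`, FILE 34 §3)
      (∀ (Dl Ds : Module.End ℝ (S × ι → ℝ)),
        HasMajorant (g := toB6 g Rr H) (fun p : S × ι => blk p.1) (Dl * Gp) (fun a a' => BG * g.len a * Real.exp (-(δ₀ * g.dist a a'))) →
        HasMajorant (g := toB6 g Rr H) (fun p : S × ι => blk p.1) (Gp * Ds) (fun a a' => BG * g.len a * Real.exp (-(δ₀ * g.dist a a'))) →
      ∀ (Φ : (S → 𝔸) →ₗ[ℝ] 𝔸) (y : g.Site) (p₀ : S × ι), blk p₀.1 = y →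
      ∀ (γ Bh cζ : ℝ), 0 ≤ Bh → 0 ≤ cζ →
        -- (3.43) with the derivative `D_l` on the left FOR `U`, this functional
        (∀ (y'' : g.Site) (ν : S × ι → ℝ) (C : ℝ), BlockSupp (g := toB6 g Rr H) (fun p : S × ι => blk p.1) ν y'' C →
          ‖Φ ((coordEquiv b).symm (Dl (Gp ν)))‖ ≤ Bh * g.len y ^ (1 - γ) * cζ * Real.exp (-(δ₀ * g.dist y y'')) * C) →
      ∀ (y' : g.Site) (μ : S × ι → ℝ) (M : ℝ), BlockSupp (g := toB6 g Rr H) (fun p : S × ι => blk p.1) μ y' M →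
      ∀ (N : ℝ), 0 ≤ N →
        (∀ (k : κ ⊕ κ) (z : S × ι), |(((conj b (diffLetter T U ((g.eta : ℂ)⁻¹) k)) * Gp * Ds) μ) z| ≤ N * Real.exp (-(δ₀ * g.dist (blk z.1) y'))) →
      -- (3.45) FOR `U`, THIS INPUT AND THIS FUNCTIONAL (in print `N₂ = B′₀(ε,β)(Lʲη)^{−β}(‖ζ‖_β^ξ + |ζ|)(…)`)
      ∀ (N₂ : ℝ), 0 ≤ N₂ → ‖Φ ((coordEquiv b).symm ((Dl * Gp * Ds) μ))‖ ≤ N₂ * Real.exp (-(δ₀ * g.dist y y')) →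
        ‖Φ ((coordEquiv b).symm ((Dl * (gPrimeExtEnd Gp (conj b (vPrimeConc T U g.eta A blk kQ kF sQ sF cfun) * Gp)) * Ds) μ))‖ ≤
          B * (N₂ + Bh * g.len y ^ (1 - γ) * cζ * (g.len y)⁻¹ * (N + M)) * Real.exp (-(4 / 5 * δ₀ * g.dist y y'))) := by
  classical
  -- the scale-transfer constants of the chain, READ FROM THE GIVEN FUNCTION `Λf` (lattice-free)
  have hΛ : 1 ≤ Λf (1 / 20) := hΛf _ (by norm_num)
  -- FILE 45 (identities, left-entry operator clause) and FILE 54 §4 (the (3.43)-left member of `G′(U′U)` per functional) — the uniform twins, BEFORE THE LATTICE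
  obtain ⟨a₁, ha₁, B', hB', H26⟩ := thm34_Gp_uniform b κ d δ₀ BG Cq a₀ d₀ M₂ Λf hBG hCq ha₀ hM₂ hδ₀ hΛf hrepr
  obtain ⟨a₃, ha₃, B₃, hB₃, H34⟩ := thm34_Gp_holderLeft_uniform b κ d δ₀ BG Cq a₀ d₀ M₂ Λf hBG hCq ha₀ hM₂ hδ₀ hΛf hrepr
  -- the geometry of the cascade: exponents `1/20` at the printed rate `δ₀`
  have hΛ0 : 0 ≤ (Λf (1 / 20)) := zero_le_one.trans hΛ
  have hc₂ : 0 ≤ (B6.c1 d δ₀ (1 / 20)) := B6RandomWalk.c1_nonneg d δ₀ (1 / 20)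
  have hρ0 : (0 : ℝ) ≤ 9 / 10 * δ₀ := by linarith only [hδ₀]
  have hr : 9 / 10 * δ₀ + (1 / 20 + 1 / 20) * δ₀ ≤ δ₀ := by linarith only [hδ₀]
  have hρ₃ : (0 : ℝ) ≤ 4 / 5 * δ₀ := by linarith only [hδ₀]
  have hρ₃r : 4 / 5 * δ₀ + (1 / 20 + 1 / 20) * δ₀ ≤ 9 / 10 * δ₀ := by linarith only [hδ₀]
  have hρ₃ρ : 4 / 5 * δ₀ ≤ 9 / 10 * δ₀ := by linarith only [hδ₀]
  have hSb : 0 ≤ ∑ i, ‖b i‖ := Finset.sum_nonneg fun i _ => norm_nonneg _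
  have hE₀ : 0 ≤ (Real.exp (δ₀ * d₀)) := Real.exp_nonneg _
  -- «of course with different constants» (p. 403): the two clause constants are continuous at `α₁ = 0`, hence bounded below a threshold
  obtain ⟨KB₁, ε₁, hKB₁, hε₁, hF1⟩ := exists_bound_of_continuousAt
    (f := fun α₁ : ℝ => (1 + α₁ * B' * (Λf (1 / 20)) * (B6.c1 d δ₀ (1 / 20)) * (cVConc (Fintype.card κ) 1 α₁ a₀ Cq M₂ (∑ i, ‖b i‖) (Real.exp (δ₀ * d₀))) * (B6.c1 d δ₀ (1 / 20))) + (α₁ * B' * (Λf (1 / 20)) * (B6.c1 d δ₀ (1 / 20)) * BG * (Λf (1 / 20)) * (B6.c1 d δ₀ (1 / 20)) * ((cVConc (Fintype.card κ) 1 α₁ a₀ Cq M₂ (∑ i, ‖b i‖) (Real.exp (δ₀ * d₀))) + 0 + 0)))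
    (by
      unfold cVConc B9Eq360VprimeLetters.cBConc
      fun_prop)
  obtain ⟨KB₂, ε₂, hKB₂, hε₂, hF2⟩ := exists_bound_of_continuousAt
    (f := fun α₁ : ℝ => 1 + (B₃ * (Λf (1 / 20)) * (B6.c1 d δ₀ (1 / 20)) * (α₁ * (B6.c1 d δ₀ (1 / 20)) * (((cVConc (Fintype.card κ) 1 α₁ a₀ Cq M₂ (∑ i, ‖b i‖) (Real.exp (δ₀ * d₀))) + 0 + 0) * BG * (Λf (1 / 20)) + (cVConc (Fintype.card κ) 1 α₁ a₀ Cq M₂ (∑ i, ‖b i‖) (Real.exp (δ₀ * d₀)))))))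
    (by
      unfold cVConc B9Eq360VprimeLetters.cBConc
      fun_prop)
  have hBtot : 0 ≤ KB₁ + KB₂ := add_nonneg hKB₁ hKB₂
  refine ⟨min (min (min a₁ a₃) (1 / 4)) (min (ε₁ / 2) (ε₂ / 2)),
    lt_min (lt_min (lt_min ha₁ ha₃) (by norm_num)) (lt_min (half_pos hε₁) (half_pos hε₂)), KB₁ + KB₂, hBtot, ?_⟩
  -- NOW the lattice, the background, the data, the Theorems-for-`U` inputs (block and kernel members); then `α₁`, `A` and the `A`-letters
  intro S _ _ T U g _ _ _ Rr H blk kQ sQ cfun w hdnn htri hrefl hsym hlen hlenη hη h261 hST hU1 hd₀B hd₀F hd₀0 hw hcard hkQ hsQ hcfun Δp Gp hΔpGp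
    hGpΔp h342_1 h342_2 h342_3 α₁ hα₁0 hα₁1 A kF sF hkF hsF h337B h337F h337Bτ hA hAτB
  replace H26 := H26 T U blk kQ sQ cfun w hdnn htri hrefl hsym hlen hlenη hη h261 hST hU1 hd₀B hd₀F hd₀0 hw hcard hkQ hsQ hcfun hΔpGp hGpΔp h342_1
    h342_2 h342_3
  replace H34 := H34 T U blk kQ sQ cfun w hdnn htri hrefl hsym hlen hlenη hη h261 hST hU1 hd₀B hd₀F hd₀0 hw hcard hkQ hsQ hcfun hΔpGp hGpΔp h342_1
    h342_2 h342_3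
  obtain ⟨hT1, -, hT1i, -, -, -⟩ := hST (1 / 20) (by norm_num)
  have h261β : Ineq261 d (toB6 g Rr H) δ₀ (1 / 20) := h261 _ (by norm_num) (by norm_num)
  have hm₁ : min (min (min a₁ a₃) (1 / 4)) (min (ε₁ / 2) (ε₂ / 2)) ≤ a₁ := (min_le_left _ _).trans ((min_le_left _ _).trans (min_le_left _ _))
  have hm₃ : min (min (min a₁ a₃) (1 / 4)) (min (ε₁ / 2) (ε₂ / 2)) ≤ a₃ := (min_le_left _ _).trans ((min_le_left _ _).trans (min_le_right _ _))
  have hmq : min (min (min a₁ a₃) (1 / 4)) (min (ε₁ / 2) (ε₂ / 2)) ≤ 1 / 4 := (min_le_left _ _).trans (min_le_right _ _)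
  have hmε₁ : min (min (min a₁ a₃) (1 / 4)) (min (ε₁ / 2) (ε₂ / 2)) ≤ ε₁ / 2 := (min_le_right _ _).trans (min_le_left _ _)
  have hmε₂ : min (min (min a₁ a₃) (1 / 4)) (min (ε₁ / 2) (ε₂ / 2)) ≤ ε₂ / 2 := (min_le_right _ _).trans (min_le_right _ _)
  have hα₁a : α₁ ≤ a₁ := hα₁1.trans hm₁
  have hα₁c : α₁ ≤ a₃ := hα₁1.trans hm₃
  have hα₁q : α₁ ≤ 1 / 4 := hα₁1.trans hmq
  have habs : |α₁| = α₁ := abs_of_nonneg hα₁0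
  have hα₁ε₁ : |α₁| < ε₁ := by rw [habs]; linarith only [hα₁1, hmε₁, hε₁]
  have hα₁ε₂ : |α₁| < ε₂ := by rw [habs]; linarith only [hα₁1, hmε₂, hε₂]
  -- FILE 26 at this `α₁`, `A`: identities and the left-entry operator clause; FILE 34 §4: the (3.43)-left clause for `G′(U′U)`
  obtain ⟨e1, e2, hGpL, -⟩ := H26 α₁ hα₁0 hα₁a A kF sF hkF hsF h337B h337F h337Bτ hA hAτB
  have hGLp := H34 α₁ hα₁0 hα₁c A kF sF hkF hsF h337B h337F h337Bτ hA hAτB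
  -- the shapes in which the letter lemmas read (3.37), the transports and the stencil geometry; «η·α₁(Lʲη)⁻¹ ≦ 1/4»
  have hsmall : ∀ z : g.Site, g.eta * (α₁ * (g.len z)⁻¹) ≤ 1 / 4 := fun z => by
    have hq : g.eta * (g.len z)⁻¹ ≤ 1 := by
      rw [← div_eq_mul_inv]; exact (div_le_one (hlen z)).mpr (hlenη z)
    calc g.eta * (α₁ * (g.len z)⁻¹) = α₁ * (g.eta * (g.len z)⁻¹) := by ring
      _ ≤ α₁ * 1 := mul_le_mul_of_nonneg_left hq hα₁0
      _ ≤ 1 / 4 := by linarith only [hα₁q]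
  have hA' : ∀ μ x, ‖A μ x‖ ≤ α₁ * (g.len (blk x))⁻¹ ∧ ‖tauB T U μ (A μ) x‖ ≤ α₁ * (g.len (blk x))⁻¹ :=
    fun μ x => ⟨hA μ x, hAτB μ μ x⟩
  have h337s' : ∀ μ x, ‖((g.eta : ℂ)⁻¹) • covDstar T U μ (A μ) x‖ ≤ α₁ * (g.len (blk x) ^ 2)⁻¹ := fun μ x => h337B μ μ x
  have hd₀' : ∀ μ x, g.dist (blk x) (blk (T μ x)) ≤ d₀ ∧ g.dist (blk x) (blk ((T μ).symm x)) ≤ d₀ :=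
    fun μ x => ⟨hd₀F μ x, hd₀B μ x⟩
  -- the concrete `V′(A)` of (3.60): gradient form, the zeroth-order size at `cVConc`, the first-order sizes, no `P₁`, `P₂`
  have hV₃ := conj_vPrimeConc_eq_gradForm b T U g.eta A blk kQ kF sQ sF cfun
  have hcC0 : 0 ≤ ((2 + 8 * (1 : ℝ) ^ 2 * α₁) * Fintype.card κ + a₀ * Cq * (2 + Cq * α₁)) * M₂ * (∑ i, ‖b i‖) * (Real.exp (δ₀ * d₀)) := by positivity
  have hcV : 0 ≤ (cVConc (Fintype.card κ) 1 α₁ a₀ Cq M₂ (∑ i, ‖b i‖) (Real.exp (δ₀ * d₀))) := cVConc_nonneg hα₁0 ha₀ hCq hM₂ hSb hE₀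
  have hV0 : HasMajorant (g := toB6 g Rr H) (fun p : S × ι => blk p.1)
      (conj b (V0op T U g.eta A) - conj b (avgOp blk kQ kF sQ sF cfun))
      (fun y y' => (cVConc (Fintype.card κ) 1 α₁ a₀ Cq M₂ (∑ i, ‖b i‖) (Real.exp (δ₀ * d₀))) * α₁ * (g.len y ^ 2)⁻¹ * Real.exp (-(δ₀ * g.dist y y'))) := by
    refine hasMajorant_mono (g := toB6 g Rr H) _
      (hasMajorant_V0_vPrime b T U blk hη A kQ kF sQ sF cfun w 1 d₀ δ₀ M₂ α₁ Cq a₀ hα₁0 hδ₀.le hM₂ hrepr hlen hsmall hA' h337s' hU1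
        hd₀' hd₀0 hw hcard hCq ha₀ hkQ hkF hsQ hsF hcfun) fun y y' => ?_
    have hw2 : 0 ≤ (g.len y ^ 2)⁻¹ := inv_nonneg.mpr (sq_nonneg _)
    have hε : 0 ≤ Real.exp (-(δ₀ * g.dist y y')) := Real.exp_nonneg _
    have hle : ((2 + 8 * (1 : ℝ) ^ 2 * α₁) * Fintype.card κ + a₀ * Cq * (2 + Cq * α₁)) * M₂ * (∑ i, ‖b i‖) * (Real.exp (δ₀ * d₀)) ≤ (cVConc (Fintype.card κ) 1 α₁ a₀ Cq M₂ (∑ i, ‖b i‖) (Real.exp (δ₀ * d₀))) := by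
      have hcB : 0 ≤ B9Eq360VprimeLetters.cBConc (Fintype.card κ) M₂ (∑ i, ‖b i‖) (Real.exp (δ₀ * d₀)) := by
        unfold B9Eq360VprimeLetters.cBConc; positivity
      unfold cVConc; linarith
    gcongr
  have hV1 : ∀ k ∈ (Finset.univ : Finset (κ ⊕ κ)), HasMajorant (g := toB6 g Rr H) (fun p : S × ι => blk p.1) (conj b (coefLetter T U A k))
      (fun y y' => (2 * M₂ * (∑ i, ‖b i‖) * Real.exp (δ₀ * d₀)) * α₁ * (g.len y)⁻¹ * Real.exp (-(δ₀ * g.dist y y'))) :=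
    fun k _ => hasMajorant_coefLetter b T U blk A d₀ δ₀ M₂ α₁ hα₁0 hδ₀.le hM₂ hrepr hlen hA' hd₀0 k
  have hcK0 : ∀ k ∈ (Finset.univ : Finset (κ ⊕ κ)), (0 : ℝ) ≤ (2 * M₂ * (∑ i, ‖b i‖) * Real.exp (δ₀ * d₀)) := fun k _ => by positivity
  have hsum : ∑ _k ∈ (Finset.univ : Finset (κ ⊕ κ)), (2 * M₂ * (∑ i, ‖b i‖) * Real.exp (δ₀ * d₀)) ≤ (cVConc (Fintype.card κ) 1 α₁ a₀ Cq M₂ (∑ i, ‖b i‖) (Real.exp (δ₀ * d₀))) := by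
    rw [Finset.sum_const, Finset.card_univ, Fintype.card_sum, nsmul_eq_mul, Nat.cast_add, cVConc, B9Eq360VprimeLetters.cBConc]
    nlinarith [hcC0]
  have hP : HasMajorant (g := toB6 g Rr H) (fun p : S × ι => blk p.1) (0 : Module.End ℝ (S × ι → ℝ))
      (fun a a' => 0 * α₁ * (g.len a ^ 2)⁻¹ * Real.exp (-(δ₀ * g.dist a a'))) :=
    hasMajorant_mono (g := toB6 g Rr H) _ (hasMajorant_zero (g := toB6 g Rr H) _) fun a a' => le_of_eq (by ring)
  -- `G′(U′U)(Δ′_a(U) − V′(A)) = 1` with `V′(A) = vTotal V′(A) 0 0`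
  have hE : (gPrimeExtEnd Gp (conj b (vPrimeConc T U g.eta A blk kQ kF sQ sF cfun) * Gp)) * (Δp - vTotal (conj b (vPrimeConc T U g.eta A blk kQ kF sQ sF cfun)) (0 : Module.End ℝ (S × ι → ℝ)) 0) = 1 := by
    simpa only [vTotal, add_zero] using e2
  -- common non-negativities and the clause constants at this `α₁`
  have hw1 : ∀ a : g.Site, 0 ≤ g.len a := fun a => (hlen a).le
  have hK1 := hF1 α₁ hα₁ε₁
  have hK2 := hF2 α₁ hα₁ε₂
  have hcoefN : 0 ≤ (1 + α₁ * B' * (Λf (1 / 20)) * (B6.c1 d δ₀ (1 / 20)) * (cVConc (Fintype.card κ) 1 α₁ a₀ Cq M₂ (∑ i, ‖b i‖) (Real.exp (δ₀ * d₀))) * (B6.c1 d δ₀ (1 / 20))) := by positivity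
  have hcoefM : 0 ≤ (α₁ * B' * (Λf (1 / 20)) * (B6.c1 d δ₀ (1 / 20)) * BG * (Λf (1 / 20)) * (B6.c1 d δ₀ (1 / 20)) * ((cVConc (Fintype.card κ) 1 α₁ a₀ Cq M₂ (∑ i, ‖b i‖) (Real.exp (δ₀ * d₀))) + 0 + 0)) := by positivity
  have hcoefVI : 0 ≤ (B₃ * (Λf (1 / 20)) * (B6.c1 d δ₀ (1 / 20)) * (α₁ * (B6.c1 d δ₀ (1 / 20)) * (((cVConc (Fintype.card κ) 1 α₁ a₀ Cq M₂ (∑ i, ‖b i‖) (Real.exp (δ₀ * d₀))) + 0 + 0) * BG * (Λf (1 / 20)) + (cVConc (Fintype.card κ) 1 α₁ a₀ Cq M₂ (∑ i, ‖b i‖) (Real.exp (δ₀ * d₀)))))) := by positivity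
  refine ⟨e1, e2, ?_, ?_⟩
  · -- (v′) the (3.44)-type member
    intro Dl Ds hDlG hGDs y' μ M hμ N hN h344 h344l x
    have hM : 0 ≤ M := hμ.nonneg
    have hDlE := hGpL Dl (fun a => g.len a) hw1 hDlG
    have hdev := input344_of_inverse (R := Rr) (H := H) (fun p : S × ι => blk p.1) d (Finset.univ : Finset (κ ⊕ κ))
      δ₀ δ₀ (1 / 20) (1 / 20) (9 / 10 * δ₀) (Λf (1 / 20)) (cVConc (Fintype.card κ) 1 α₁ a₀ Cq M₂ (∑ i, ‖b i‖) (Real.exp (δ₀ * d₀))) 0 0 α₁ BG δ₀ (1 / 20) (1 / 20) (Λf (1 / 20)) (9 / 10 * δ₀) (4 / 5 * δ₀) B'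
      (fun _ => (2 * M₂ * (∑ i, ‖b i‖) * Real.exp (δ₀ * d₀)))
      hBG.le hcV le_rfl le_rfl hα₁0 hΛ0 hρ0 (by norm_num) (by norm_num) hδ₀.le hr hcK0 hsum hΛ0 hB' hρ₃ hρ₃r hρ₃ρ hdnn htri hlen h261β h261β hT1 hT1i
      (P₁ := 0) (P₂ := 0)
      (V1 := fun k => conj b (coefLetter T U A k))
      (D := fun k => conj b (diffLetter T U ((g.eta : ℂ)⁻¹) k))
      hV₃ hΔpGp hE hV0 hV1 hP hP hGDs hDlE y' μ M hμ N hN (fun k _ z => h344 k z) h344l x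
    refine hdev.trans ?_
    have hEx : 0 ≤ Real.exp (-(4 / 5 * δ₀ * g.dist (blk x.1) y')) := Real.exp_nonneg _
    have h1 : N * (1 + α₁ * B' * (Λf (1 / 20)) * (B6.c1 d δ₀ (1 / 20)) * (cVConc (Fintype.card κ) 1 α₁ a₀ Cq M₂ (∑ i, ‖b i‖) (Real.exp (δ₀ * d₀))) * (B6.c1 d δ₀ (1 / 20))) ≤ N * ((1 + α₁ * B' * (Λf (1 / 20)) * (B6.c1 d δ₀ (1 / 20)) * (cVConc (Fintype.card κ) 1 α₁ a₀ Cq M₂ (∑ i, ‖b i‖) (Real.exp (δ₀ * d₀))) * (B6.c1 d δ₀ (1 / 20))) + (α₁ * B' * (Λf (1 / 20)) * (B6.c1 d δ₀ (1 / 20)) * BG * (Λf (1 / 20)) * (B6.c1 d δ₀ (1 / 20)) * ((cVConc (Fintype.card κ) 1 α₁ a₀ Cq M₂ (∑ i, ‖b i‖) (Real.exp (δ₀ * d₀))) + 0 + 0))) := mul_le_mul_of_nonneg_left (le_add_of_nonneg_right hcoefM) hN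
    have h2 : M * (α₁ * B' * (Λf (1 / 20)) * (B6.c1 d δ₀ (1 / 20)) * BG * (Λf (1 / 20)) * (B6.c1 d δ₀ (1 / 20)) * ((cVConc (Fintype.card κ) 1 α₁ a₀ Cq M₂ (∑ i, ‖b i‖) (Real.exp (δ₀ * d₀))) + 0 + 0)) ≤ M * ((1 + α₁ * B' * (Λf (1 / 20)) * (B6.c1 d δ₀ (1 / 20)) * (cVConc (Fintype.card κ) 1 α₁ a₀ Cq M₂ (∑ i, ‖b i‖) (Real.exp (δ₀ * d₀))) * (B6.c1 d δ₀ (1 / 20))) + (α₁ * B' * (Λf (1 / 20)) * (B6.c1 d δ₀ (1 / 20)) * BG * (Λf (1 / 20)) * (B6.c1 d δ₀ (1 / 20)) * ((cVConc (Fintype.card κ) 1 α₁ a₀ Cq M₂ (∑ i, ‖b i‖) (Real.exp (δ₀ * d₀))) + 0 + 0))) := mul_le_mul_of_nonneg_left (le_add_of_nonneg_left hcoefN) hM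
    have h3 : (N + M) * ((1 + α₁ * B' * (Λf (1 / 20)) * (B6.c1 d δ₀ (1 / 20)) * (cVConc (Fintype.card κ) 1 α₁ a₀ Cq M₂ (∑ i, ‖b i‖) (Real.exp (δ₀ * d₀))) * (B6.c1 d δ₀ (1 / 20))) + (α₁ * B' * (Λf (1 / 20)) * (B6.c1 d δ₀ (1 / 20)) * BG * (Λf (1 / 20)) * (B6.c1 d δ₀ (1 / 20)) * ((cVConc (Fintype.card κ) 1 α₁ a₀ Cq M₂ (∑ i, ‖b i‖) (Real.exp (δ₀ * d₀))) + 0 + 0))) ≤ (N + M) * (KB₁ + KB₂) :=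
      mul_le_mul_of_nonneg_left (hK1.trans (le_add_of_nonneg_right hKB₂)) (add_nonneg hN hM)
    have h4 : N * (1 + α₁ * B' * (Λf (1 / 20)) * (B6.c1 d δ₀ (1 / 20)) * (cVConc (Fintype.card κ) 1 α₁ a₀ Cq M₂ (∑ i, ‖b i‖) (Real.exp (δ₀ * d₀))) * (B6.c1 d δ₀ (1 / 20))) + M * (α₁ * B' * (Λf (1 / 20)) * (B6.c1 d δ₀ (1 / 20)) * BG * (Λf (1 / 20)) * (B6.c1 d δ₀ (1 / 20)) * ((cVConc (Fintype.card κ) 1 α₁ a₀ Cq M₂ (∑ i, ‖b i‖) (Real.exp (δ₀ * d₀))) + 0 + 0)) ≤ (KB₁ + KB₂) * (N + M) := by linarith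
    exact mul_le_mul_of_nonneg_right h4 hEx
  · -- (vi′) the (3.45)-type member
    intro Dl Ds hDlG hGDs Φ y p₀ hp₀ γ Bh cζ hBh hcζ h343 y' μ M hμ N hN h344 N₂ hN₂ h345
    have hM : 0 ≤ M := hμ.nonneg
    have hA₃ : 0 ≤ B₃ * Bh * g.len y ^ (1 - γ) * cζ := mul_nonneg (mul_nonneg (mul_nonneg hB₃ hBh) (Real.rpow_nonneg (hlen y).le _)) hcζ
    -- FILE 34 §4: the (3.43)-left member of `G′(U′U)` for the functional `Φ ∘ coord⁻¹ ∘ D_l`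
    have hΨE : ∀ (y'' : g.Site) (ν : S × ι → ℝ) (C : ℝ), BlockSupp (g := toB6 g Rr H) (fun p : S × ι => blk p.1) ν y'' C →
        ‖(Φ ∘ₗ (coordEquiv (S := S) b).symm.toLinearMap ∘ₗ Dl) ((gPrimeExtEnd Gp (conj b (vPrimeConc T U g.eta A blk kQ kF sQ sF cfun) * Gp)) ν)‖ ≤
          B₃ * Bh * g.len y ^ (1 - γ) * cζ * Real.exp (-(9 / 10 * δ₀ * g.dist y y'')) * C := fun y'' ν C hν => by
      simpa only [LinearMap.coe_comp, Function.comp_apply, LinearEquiv.coe_toLinearMap] using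
        hGLp Dl Φ y p₀ hp₀ γ Bh cζ hBh hcζ h343 y'' ν C hν
    have hdev := input345_of_inverse (R := Rr) (H := H) (fun p : S × ι => blk p.1) d (Finset.univ : Finset (κ ⊕ κ))
      δ₀ δ₀ (1 / 20) (1 / 20) (9 / 10 * δ₀) (Λf (1 / 20)) (cVConc (Fintype.card κ) 1 α₁ a₀ Cq M₂ (∑ i, ‖b i‖) (Real.exp (δ₀ * d₀))) 0 0 α₁ BG δ₀ (1 / 20) (1 / 20) (Λf (1 / 20)) (9 / 10 * δ₀) (4 / 5 * δ₀)
      (B₃ * Bh * g.len y ^ (1 - γ) * cζ) (fun _ => (2 * M₂ * (∑ i, ‖b i‖) * Real.exp (δ₀ * d₀)))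
      hBG.le hcV le_rfl le_rfl hα₁0 hΛ0 hρ0 (by norm_num) (by norm_num) hδ₀.le hr hcK0 hsum hΛ0 hA₃ hρ₃ hρ₃r hρ₃ρ hdnn htri hlen h261β h261β hT1 hT1i
      (P₁ := 0) (P₂ := 0)
      (V1 := fun k => conj b (coefLetter T U A k))
      (D := fun k => conj b (diffLetter T U ((g.eta : ℂ)⁻¹) k))
      hV₃ hΔpGp hE hV0 hV1 hP hP hGDs (Φ ∘ₗ (coordEquiv (S := S) b).symm.toLinearMap ∘ₗ Dl) y hΨE y' μ M hμ N hN
      (fun k _ z => h344 k z) N₂ hN₂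
      (by simpa only [LinearMap.coe_comp, Function.comp_apply, LinearEquiv.coe_toLinearMap, Module.End.mul_apply] using h345)
    have hdev' : ‖Φ ((coordEquiv b).symm ((Dl * (gPrimeExtEnd Gp (conj b (vPrimeConc T U g.eta A blk kQ kF sQ sF cfun) * Gp)) * Ds) μ))‖ ≤
        (N₂ + B₃ * Bh * g.len y ^ (1 - γ) * cζ * (Λf (1 / 20)) * (B6.c1 d δ₀ (1 / 20)) * (g.len y)⁻¹ *
          (α₁ * (B6.c1 d δ₀ (1 / 20)) * (((cVConc (Fintype.card κ) 1 α₁ a₀ Cq M₂ (∑ i, ‖b i‖) (Real.exp (δ₀ * d₀))) + 0 + 0) * BG * (Λf (1 / 20)) * M + (cVConc (Fintype.card κ) 1 α₁ a₀ Cq M₂ (∑ i, ‖b i‖) (Real.exp (δ₀ * d₀))) * N))) *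
        Real.exp (-(4 / 5 * δ₀ * g.dist y y')) := by
      simpa only [LinearMap.coe_comp, Function.comp_apply, LinearEquiv.coe_toLinearMap, Module.End.mul_apply] using hdev
    refine hdev'.trans ?_
    have hEx : 0 ≤ Real.exp (-(4 / 5 * δ₀ * g.dist y y')) := Real.exp_nonneg _
    have hS : 0 ≤ Bh * g.len y ^ (1 - γ) * cζ * (g.len y)⁻¹ * (N + M) :=
      mul_nonneg (mul_nonneg (mul_nonneg (mul_nonneg hBh (Real.rpow_nonneg (hlen y).le _)) hcζ) (inv_nonneg.mpr (hlen y).le))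
        (add_nonneg hN hM)
    have hQq : α₁ * (B6.c1 d δ₀ (1 / 20)) * (((cVConc (Fintype.card κ) 1 α₁ a₀ Cq M₂ (∑ i, ‖b i‖) (Real.exp (δ₀ * d₀))) + 0 + 0) * BG * (Λf (1 / 20)) * M + (cVConc (Fintype.card κ) 1 α₁ a₀ Cq M₂ (∑ i, ‖b i‖) (Real.exp (δ₀ * d₀))) * N) ≤ (α₁ * (B6.c1 d δ₀ (1 / 20)) * (((cVConc (Fintype.card κ) 1 α₁ a₀ Cq M₂ (∑ i, ‖b i‖) (Real.exp (δ₀ * d₀))) + 0 + 0) * BG * (Λf (1 / 20)) + (cVConc (Fintype.card κ) 1 α₁ a₀ Cq M₂ (∑ i, ‖b i‖) (Real.exp (δ₀ * d₀))))) * (N + M) := by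
      have i1 : ((cVConc (Fintype.card κ) 1 α₁ a₀ Cq M₂ (∑ i, ‖b i‖) (Real.exp (δ₀ * d₀))) + 0 + 0) * BG * (Λf (1 / 20)) * M ≤ ((cVConc (Fintype.card κ) 1 α₁ a₀ Cq M₂ (∑ i, ‖b i‖) (Real.exp (δ₀ * d₀))) + 0 + 0) * BG * (Λf (1 / 20)) * (N + M) :=
        mul_le_mul_of_nonneg_left (le_add_of_nonneg_left hN) (by positivity)
      have i2 : (cVConc (Fintype.card κ) 1 α₁ a₀ Cq M₂ (∑ i, ‖b i‖) (Real.exp (δ₀ * d₀))) * N ≤ (cVConc (Fintype.card κ) 1 α₁ a₀ Cq M₂ (∑ i, ‖b i‖) (Real.exp (δ₀ * d₀))) * (N + M) := mul_le_mul_of_nonneg_left (le_add_of_nonneg_right hM) hcV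
      have i3 := add_le_add i1 i2
      have e : (α₁ * (B6.c1 d δ₀ (1 / 20)) * (((cVConc (Fintype.card κ) 1 α₁ a₀ Cq M₂ (∑ i, ‖b i‖) (Real.exp (δ₀ * d₀))) + 0 + 0) * BG * (Λf (1 / 20)) + (cVConc (Fintype.card κ) 1 α₁ a₀ Cq M₂ (∑ i, ‖b i‖) (Real.exp (δ₀ * d₀))))) * (N + M) = α₁ * (B6.c1 d δ₀ (1 / 20)) * (((cVConc (Fintype.card κ) 1 α₁ a₀ Cq M₂ (∑ i, ‖b i‖) (Real.exp (δ₀ * d₀))) + 0 + 0) * BG * (Λf (1 / 20)) * (N + M) + (cVConc (Fintype.card κ) 1 α₁ a₀ Cq M₂ (∑ i, ‖b i‖) (Real.exp (δ₀ * d₀))) * (N + M)) := by ring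
      rw [e]
      exact mul_le_mul_of_nonneg_left i3 (mul_nonneg hα₁0 hc₂)
    have h1 : B₃ * Bh * g.len y ^ (1 - γ) * cζ * (Λf (1 / 20)) * (B6.c1 d δ₀ (1 / 20)) * (g.len y)⁻¹ *
          (α₁ * (B6.c1 d δ₀ (1 / 20)) * (((cVConc (Fintype.card κ) 1 α₁ a₀ Cq M₂ (∑ i, ‖b i‖) (Real.exp (δ₀ * d₀))) + 0 + 0) * BG * (Λf (1 / 20)) * M + (cVConc (Fintype.card κ) 1 α₁ a₀ Cq M₂ (∑ i, ‖b i‖) (Real.exp (δ₀ * d₀))) * N))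
        ≤ (B₃ * (Λf (1 / 20)) * (B6.c1 d δ₀ (1 / 20)) * (α₁ * (B6.c1 d δ₀ (1 / 20)) * (((cVConc (Fintype.card κ) 1 α₁ a₀ Cq M₂ (∑ i, ‖b i‖) (Real.exp (δ₀ * d₀))) + 0 + 0) * BG * (Λf (1 / 20)) + (cVConc (Fintype.card κ) 1 α₁ a₀ Cq M₂ (∑ i, ‖b i‖) (Real.exp (δ₀ * d₀)))))) * (Bh * g.len y ^ (1 - γ) * cζ * (g.len y)⁻¹ * (N + M)) := by
      have hpre : 0 ≤ B₃ * Bh * g.len y ^ (1 - γ) * cζ * (Λf (1 / 20)) * (B6.c1 d δ₀ (1 / 20)) * (g.len y)⁻¹ :=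
        mul_nonneg (mul_nonneg (mul_nonneg hA₃ hΛ0) hc₂) (inv_nonneg.mpr (hlen y).le)
      refine (mul_le_mul_of_nonneg_left hQq hpre).trans (le_of_eq ?_)
      ring
    have h2 : (B₃ * (Λf (1 / 20)) * (B6.c1 d δ₀ (1 / 20)) * (α₁ * (B6.c1 d δ₀ (1 / 20)) * (((cVConc (Fintype.card κ) 1 α₁ a₀ Cq M₂ (∑ i, ‖b i‖) (Real.exp (δ₀ * d₀))) + 0 + 0) * BG * (Λf (1 / 20)) + (cVConc (Fintype.card κ) 1 α₁ a₀ Cq M₂ (∑ i, ‖b i‖) (Real.exp (δ₀ * d₀)))))) * (Bh * g.len y ^ (1 - γ) * cζ * (g.len y)⁻¹ * (N + M)) ≤ KB₂ * (Bh * g.len y ^ (1 - γ) * cζ * (g.len y)⁻¹ * (N + M)) :=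
      mul_le_mul_of_nonneg_right (by linarith only [hK2, hcoefVI]) hS
    have h3 : N₂ ≤ KB₂ * N₂ := by
      have : 0 ≤ (KB₂ - 1) * N₂ := mul_nonneg (by linarith only [hK2, hcoefVI]) hN₂
      linarith
    have h4 : 0 ≤ KB₁ * (N₂ + Bh * g.len y ^ (1 - γ) * cζ * (g.len y)⁻¹ * (N + M)) := mul_nonneg hKB₁ (add_nonneg hN₂ hS)
    have h5 : N₂ + B₃ * Bh * g.len y ^ (1 - γ) * cζ * (Λf (1 / 20)) * (B6.c1 d δ₀ (1 / 20)) * (g.len y)⁻¹ *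
          (α₁ * (B6.c1 d δ₀ (1 / 20)) * (((cVConc (Fintype.card κ) 1 α₁ a₀ Cq M₂ (∑ i, ‖b i‖) (Real.exp (δ₀ * d₀))) + 0 + 0) * BG * (Λf (1 / 20)) * M + (cVConc (Fintype.card κ) 1 α₁ a₀ Cq M₂ (∑ i, ‖b i‖) (Real.exp (δ₀ * d₀))) * N))
        ≤ (KB₁ + KB₂) * (N₂ + Bh * g.len y ^ (1 - γ) * cζ * (g.len y)⁻¹ * (N + M)) := by nlinarith
    exact mul_le_mul_of_nonneg_right h5 hEx

end HolderInputGpU1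

end Literature.MathematicalPhysics.QuantumFieldTheory.Balaban1983to89.B9Thm34HolderGpUniformR1
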